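import Literature.NumberTheory.EllipticCurves.HalfIntegralWeightFormsGaussSumProofs
import Literature.NumberTheory.EllipticCurves.TunnellHalfIntegralForms
import HarnessLib

/-!
# Shimura 1973, Theorem 1.7: `T(p²)` preserves `M_{k/2}(N, χ)` and `S_{k/2}(N, χ)`

Discharge of the named fact `Shimura1973_heckeTSq_mem` of `HalfIntegralWeightForms`
(`Shimura1973_heckeTSq_mem_holds`): for `k` odd, `4 ∣ N`, `χ` a Dirichlet character modulo `N`
and `p` prime, for every `f ∈ M_{k/2}(N, χ)` (resp. `S_{k/2}(N, χ)`) there is `g` in the same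
space with `qCoeffs g = heckeTSq k χ p (qCoeffs f)`, i.e.
`b(n) = a(p²n) + χ(p) ((-1)^λ n / p) p^{λ-1} a(n) + χ(p²) p^{k-2} a(n/p²)`, `λ = (k - 1)/2`.
Third and last file of the proof, after the transformation law of `θ` on `Γ₀(4)`
(`HalfIntegralWeightFormsThetaMultiplierProofs`: `θ(γz) = j(γ, z) θ(z)`,
`j(γ, z) = ε_d⁻¹ (c/d) √(cz + d)`) and the sign of the quadratic Gauss sum
(`HalfIntegralWeightFormsGaussSumProofs`: `Σ_x (x/p) e(x/p) = ε_p √p`).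

## The construction (Shimura 1973, §1 and the proof of Thm. 1.7; Koblitz IV §3, Prop. 13)

`g = T(p²) f` is the function (`heckeFun`)

  `g(z) = p⁻² [ Σ_{b mod p²} f((z + b)/p²) + χ(p) (ε_p⁻¹ √p)^k Σ_{t mod p} (t/p) f(z + t/p)
                + χ(p²) p^k f(p² z) ]`,

which is `p⁻²` times the **trace** `Σ_δ χ(d_δ)⁻¹ j(δ, z)^{-k} f((δz)/p²)` of `F(z) = f(z/p²)`
over a transversal `δ` of `Γ' \ Γ₀(N)`, `Γ' = Γ₀(N) ∩ diag(1,p²)⁻¹ Γ₀(N) diag(1,p²) =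
{p² ∣ b}` (`trace_sum_eq`, `trace_sum_eq_of_dvd`). The transversal is `{Tᵇ : b mod p²}` when
`p ∣ N` (then `χ(p) = 0`), and `{Tᵇ} ∪ {γ_s = (1 + u_s, 1; u_s, 1) : s mod p}` when `p ∤ N`, where
`N ∣ u_s`, `u_s ≡ ps - 1 (mod p²)` (Chinese remainder theorem; the cosets are classified by the
top row in `P¹(ℤ/p²)`): (T1) `exists_rep`, (T2) `rep_eq_of_dvd`.

* **Automorphy** (`heckeFun_smul`, `isThetaAutomorphic_heckeFun`). Members of `M_{k/2}(N, χ)`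
  satisfy the genuine automorphy `f(γz) = χ(d) j(γ,z)^k f(z)` (`apply_smul_eq_of_mem`; the
  division by `θ(z)^k` is done with the identity theorem, Mathlib's
  `UpperHalfPlane.mul_eq_zero_iff`, so the non-vanishing of `θ` is never needed); `j` is a
  cocycle on `Γ₀(4)` (`thetaFactor_cocycle`, same argument); `F` is automorphic for `Γ'`
  because `j` is compatible with conjugation by `diag(1, p²)` (`autFactor_conjPSq`,
  `(p²c/d) = (c/d)`); and the trace of a `Γ'`-automorphic function over a transversal is
  `Γ₀(N)`-automorphic (`trace_smul`: right multiplication permutes the cosets, the cocycle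
  relation moves the factors).
* **Evaluation** (`trace_inr_eq`). `diag(1,p²) γ_s = η_s (p h_s; 0 p)` with `h_s ≡ s⁻¹ (mod p)`
  and `η_s = ((1+u_s)/p, (p - h_s(1+u_s))/p²; p u_s, p - h_s u_s) ∈ Γ₀(N)` (`etaS`,
  `divPSq_gammaS_smul`), `diag(1,p²) γ_0 = η_0 diag(p², 1)` (`etaZ`); the factors are
  `χ(p) (ε_p⁻¹ (h_s/p) √p √(u_s z + 1))^k` (`autFactor_etaS`: `ε_{p - hu} = ε_p` as `4 ∣ u`, and
  `(p u / p - h u) = (h/p)` by `(h / |p - hu|) = (h/p)`, `jacobiSym_natAbs_sub_eq`, two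
  applications of reciprocity) and `χ(p²) (p √(u_0 z + 1))^k` (`autFactor_etaZ`), against
  `j(γ_s, z)^k = √(u_s z + 1)^k`; reindexing `s ↦ s⁻¹` gives the displayed formula.
* **`q`-expansion** (`hasSum_heckeFun`, `qCoeffs_heckeFun`). From `f = Σ a(n) qⁿ` (`hasSum_qCoeffs`)
  and the character sums over `ℤ/p²` and `ℤ/p`: the three pieces are `Σ p² a(p²m) qᵐ`,
  `Σ (n/p) G_p a(n) qⁿ` (`sum_quadCharC_mul_stdAddChar_linear`) and `Σ_{p² ∣ m} a(m/p²) qᵐ`;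
  with `G_p = ε_p √p` (`legendreGaussSum_eq`) the middle constant is
  `p⁻² (ε_p⁻¹√p)^k ε_p √p = (-1/p)^λ p^{λ-1}` (`middle_const`, `ε_p⁻² = (-1/p)`), which is
  exactly Shimura's `((-1)^λ n / p) p^{λ-1}`; `qCoeffs_eq_of_hasSum` (`TunnellHalfIntegralForms`)
  identifies the coefficients, and the `q`-series also gives holomorphy.
* **Cusps** (`isBoundedAtImInfty_slashSq_heckeFun`, `isZeroAtImInfty_slashSq_heckeFun`). Each
  piece is `f ∘ φ` with `φ(z) = (Az + B)/D`, `A, D > 0`; for `σ ∈ SL₂(ℤ)` the Hermite form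
  `(A B; 0 D) σ = σ' (A' B'; 0 D')` (`exists_SL2_mul_upper`) gives
  `slashSq k (f ∘ φ) σ (z) = (D/D')^k slashSq k f σ' (w)`, `w = (A'z + B')/D'`, `Im w → ∞`
  (`slashSq_comp_eq`), so the conditions at all cusps transport.

## Main statements

* `autFactor k N χ γ z = χ(d) j(γ, z)^k`; `autFactor_mul` (cocycle); `apply_smul_eq_of_mem`.
* `trace_smul` (automorphy of traces over transversals), `heckeFun`, `heckeFun_smul`,
  `qCoeffs_heckeFun`, `heckeFun_mem`, `heckeFun_mem_cuspForms`.
* `Shimura1973_heckeTSq_mem_holds`.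

## References

* G. Shimura, *On modular forms of half integral weight*, Ann. of Math. 97 (1973) 440–481: §1
  (the automorphy factor and the double cosets `Δ₀(N) ξ Δ₀(N)`), Thm. 1.7 (the action of
  `T(p²)` on `q`-expansions). Not held while this file was written; the construction follows
  Koblitz's account. [Shimura1973HalfIntegral]
* N. Koblitz, *Introduction to Elliptic Curves and Modular Forms*, GTM 97, Ch. IV, §3,
  Prop. 13 and its proof (the explicit coset representatives for `T_{p²}`).
* K. Ireland, M. Rosen, *A Classical Introduction to Modern Number Theory* (1982), Ch. 6 §4
  (the Gauss sum). [IrelandRosen1982]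
-/

noncomputable section

open UpperHalfPlane hiding I
open Complex ModularGroup Matrix.SpecialLinearGroup CongruenceSubgroup
open scoped MatrixGroups Real NumberTheorySymbols

namespace Literature.NumberTheory.EllipticCurves.ModularForms

/-! ## Part 3. The automorphy factor `χ(d) j(γ,z)^k`, its cocycle relation, and the trace -/

section HeckeA

open scoped Manifold

variable {k N : ℕ} {χ : DirichletCharacter ℂ N}

/-! ### Holomorphy of `z ↦ √(cz + d)` and of `j(γ, z)` -/

/-- `z ↦ √(cz + d)` is holomorphic on `ℍ` when `c ≠ 0` (then `cz + d` avoids the real axis) or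
`c = 0` (a constant). [folklore] -/
theorem mdifferentiable_csqrt_linear (c d : ℤ) :
    MDiff (fun z : ℍ ↦ Complex.sqrt ((c : ℂ) * z + d)) := by
  rcases eq_or_ne c 0 with rfl | hc
  · have : (fun z : ℍ ↦ Complex.sqrt (((0 : ℤ) : ℂ) * z + d)) = fun _ ↦ Complex.sqrt d := by
      funext z; simp
    rw [this]
    exact mdifferentiable_const
  · rw [UpperHalfPlane.mdifferentiable_iff]
    intro w hw
    have hw' : 0 < w.im := hw
    have hslit : (c : ℂ) * w + d ∈ Complex.slitPlane := by
      rw [Complex.mem_slitPlane_iff]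
      right
      simpa using ⟨hc, hw'.ne'⟩
    have hd : DifferentiableAt ℂ (fun w : ℂ ↦ Complex.sqrt ((c : ℂ) * w + d)) w := by
      unfold Complex.sqrt
      exact ((differentiableAt_id.const_mul _).add_const _).cpow_const hslit
    refine (hd.congr_of_eventuallyEq ?_).differentiableWithinAt
    filter_upwards [isOpen_upperHalfPlaneSet.mem_nhds hw] with u hu
    simp only [Function.comp_apply, ofComplex_apply_of_im_pos hu, UpperHalfPlane.coe_mk]

/-- `z ↦ j(γ, z) = ε_d⁻¹ (c/d) √(cz + d)` is holomorphic on `ℍ`. [folklore] -/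
theorem mdifferentiable_thetaFactor (c d : ℤ) : MDiff (fun z : ℍ ↦ thetaFactor c d z) := by
  unfold thetaFactor
  exact (mdifferentiable_const.mul mdifferentiable_const).mul (mdifferentiable_csqrt_linear c d)

/-- Holomorphic functions compose with the action of `SL₂(ℤ)`. [folklore] -/
theorem mdifferentiable_comp_smul {F : ℍ → ℂ} (hF : MDiff F) (γ : SL(2, ℤ)) :
    MDiff (fun z : ℍ ↦ F (γ • z)) := by
  have h : MDiff (fun z : ℍ ↦ (γ : GL (Fin 2) ℝ) • z) :=
    UpperHalfPlane.mdifferentiable_smul (by simp)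
  exact hF.comp h

/-- `θ^k ≠ 0` as a function (`θ(i) ≠ 0`). [folklore] -/
theorem shimuraTheta_pow_ne_zero (k : ℕ) : (fun z : ℍ ↦ shimuraTheta z ^ k) ≠ 0 := by
  intro h
  have := congrFun h UpperHalfPlane.I
  simp only [Pi.zero_apply, pow_eq_zero_iff', ne_eq] at this
  exact shimuraTheta_I_ne_zero this.1

/-- **Division by `θ^k` through the identity theorem**: a holomorphic `G` on `ℍ` with
`G(z) θ(z)^k = 0` for all `z` vanishes identically (`θ ≢ 0`, `ℍ` connected; Mathlib's
`UpperHalfPlane.mul_eq_zero_iff`). This replaces the non-vanishing of `θ` on `ℍ`, which we do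
not prove. [folklore] -/
theorem eq_zero_of_mul_shimuraTheta_pow {G : ℍ → ℂ} (hG : MDiff G) (k : ℕ)
    (h : ∀ z, G z * shimuraTheta z ^ k = 0) : G = 0 := by
  have hθ : MDiff (fun z : ℍ ↦ shimuraTheta z ^ k) := mdifferentiable_shimuraTheta.pow k
  have hprod : G * (fun z : ℍ ↦ shimuraTheta z ^ k) = 0 := funext fun z ↦ h z
  rcases (UpperHalfPlane.mul_eq_zero_iff hG hθ).mp hprod with h0 | h0
  · exact h0
  · exact absurd h0 (shimuraTheta_pow_ne_zero k)

/-! ### The cocycle relation of `j(γ, z)` on `Γ₀(4)` -/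

/-- **`j` is a cocycle on `Γ₀(4)`**: `j(γ₁γ₂, z) = j(γ₁, γ₂z) j(γ₂, z)` (exactly, with the
principal branches): both sides multiplied by `θ(z)` give `θ(γ₁γ₂z)`, and `θ ≢ 0`.
[cite: Shimura1973HalfIntegral, §1] -/
theorem thetaFactor_cocycle {γ₁ γ₂ : SL(2, ℤ)} (h₁ : γ₁ ∈ Gamma0 4) (h₂ : γ₂ ∈ Gamma0 4) (z : ℍ) :
    thetaFactor ((γ₁ * γ₂) 1 0) ((γ₁ * γ₂) 1 1) z =
      thetaFactor (γ₁ 1 0) (γ₁ 1 1) (γ₂ • z) * thetaFactor (γ₂ 1 0) (γ₂ 1 1) z := by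
  have hGd : MDiff (fun z : ℍ ↦ thetaFactor ((γ₁ * γ₂) 1 0) ((γ₁ * γ₂) 1 1) z -
      thetaFactor (γ₁ 1 0) (γ₁ 1 1) (γ₂ • z) * thetaFactor (γ₂ 1 0) (γ₂ 1 1) z) :=
    (mdifferentiable_thetaFactor _ _).sub
      ((mdifferentiable_comp_smul (mdifferentiable_thetaFactor _ _) γ₂).mul
        (mdifferentiable_thetaFactor _ _))
  have h0 := eq_zero_of_mul_shimuraTheta_pow hGd 1 (fun w ↦ by
    rw [pow_one, sub_mul, mul_assoc, ← shimuraTheta_smul_eq_thetaFactor (dvd_refl 4) h₂ w,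
      ← shimuraTheta_smul_eq_thetaFactor (dvd_refl 4) h₁ (γ₂ • w),
      ← shimuraTheta_smul_eq_thetaFactor (dvd_refl 4) (mul_mem h₁ h₂) w, mul_smul, sub_self])
  have := congrFun h0 z
  simp only [Pi.zero_apply, sub_eq_zero] at this
  exact this

/-! ### The automorphy factor of weight `k/2`, level `N`, character `χ` -/

variable (k N χ) in
/-- **The automorphy factor `χ(d) j(γ, z)^k`** of weight `k/2`, level `N` and character `χ`
at `γ = (a b; c d)`: `f ∈ M_{k/2}(N, χ)` means `f(γz) = χ(d) j(γ, z)^k f(z)` for `γ ∈ Γ₀(N)`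
(`apply_smul_eq_of_mem`). [cite: Shimura1973HalfIntegral, §1] -/
def autFactor (γ : SL(2, ℤ)) (z : ℍ) : ℂ :=
  χ ((γ 1 1 : ℤ) : ZMod N) * thetaFactor (γ 1 0) (γ 1 1) z ^ k

/-- `d` is a unit modulo `N` for `(a b; c d) ∈ Γ₀(N)` (`ad ≡ 1`). [folklore] -/
theorem isUnit_d_of_mem_Gamma0 {γ : SL(2, ℤ)} (hγ : γ ∈ Gamma0 N) :
    IsUnit ((γ 1 1 : ℤ) : ZMod N) := by
  have hdet := det_entries γ
  rw [Gamma0_mem] at hγ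
  have h : ((γ 0 0 : ℤ) : ZMod N) * ((γ 1 1 : ℤ) : ZMod N) = 1 := by
    have := congrArg (fun x : ℤ ↦ (x : ZMod N)) hdet
    simp only [Int.cast_sub, Int.cast_mul, Int.cast_one] at this
    rw [hγ, mul_zero, sub_zero] at this
    exact this
  exact IsUnit.of_mul_eq_one_right _ h

/-- `χ(d) ≠ 0` for `γ ∈ Γ₀(N)`. [folklore] -/
theorem chi_d_ne_zero {γ : SL(2, ℤ)} (hγ : γ ∈ Gamma0 N) : χ ((γ 1 1 : ℤ) : ZMod N) ≠ 0 :=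
  ((isUnit_d_of_mem_Gamma0 hγ).map χ).ne_zero

/-- `χ(d)` is multiplicative on `Γ₀(N)`: `d(γ₁γ₂) = c₁b₂ + d₁d₂ ≡ d₁d₂ (mod N)`. [folklore] -/
theorem chi_d_mul {γ₁ γ₂ : SL(2, ℤ)} (h₁ : γ₁ ∈ Gamma0 N) :
    χ (((γ₁ * γ₂) 1 1 : ℤ) : ZMod N) = χ ((γ₁ 1 1 : ℤ) : ZMod N) * χ ((γ₂ 1 1 : ℤ) : ZMod N) := by
  rw [Gamma0_mem] at h₁
  rw [← map_mul]
  congr 1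
  simp only [Matrix.SpecialLinearGroup.coe_mul, Matrix.mul_apply, Fin.sum_univ_two, Int.cast_add,
    Int.cast_mul, h₁, zero_mul, zero_add]

/-- `χ(d) j(γ,z)^k ≠ 0` for `γ ∈ Γ₀(N)`. [folklore] -/
theorem autFactor_ne_zero {γ : SL(2, ℤ)} (hγ : γ ∈ Gamma0 N) (z : ℍ) : autFactor k N χ γ z ≠ 0 :=
  mul_ne_zero (chi_d_ne_zero hγ) (pow_ne_zero _ (thetaFactor_ne_zero (gcd_c_d_eq_one γ) z))

/-- **Cocycle relation** of `χ(d) j(γ, z)^k` on `Γ₀(N)`, `4 ∣ N`. [folklore] -/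
theorem autFactor_mul (hN : 4 ∣ N) {γ₁ γ₂ : SL(2, ℤ)} (h₁ : γ₁ ∈ Gamma0 N) (h₂ : γ₂ ∈ Gamma0 N)
    (z : ℍ) : autFactor k N χ (γ₁ * γ₂) z = autFactor k N χ γ₁ (γ₂ • z) * autFactor k N χ γ₂ z := by
  unfold autFactor
  rw [chi_d_mul h₁, thetaFactor_cocycle (mem_Gamma0_four_of_dvd hN h₁)
    (mem_Gamma0_four_of_dvd hN h₂) z]
  ring

/-- `z ↦ χ(d) j(γ, z)^k` is holomorphic. [folklore] -/
theorem mdifferentiable_autFactor (γ : SL(2, ℤ)) : MDiff (fun z : ℍ ↦ autFactor k N χ γ z) :=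
  mdifferentiable_const.mul ((mdifferentiable_thetaFactor _ _).pow k)

/-! ### `M_{k/2}(N, χ)`: the multiplied-out automorphy is genuine automorphy -/

/-- **Automorphy of members of `M_{k/2}(N, χ)`**: for `f` holomorphic and theta-automorphic
(`f(γz) θ(z)^k = χ(d) θ(γz)^k f(z)`) and `γ ∈ Γ₀(N)`, `4 ∣ N`,
`f(γz) = χ(d) j(γ, z)^k f(z)` — divide by `θ(z)^k` with the identity theorem
(`eq_zero_of_mul_shimuraTheta_pow`). [cite: Shimura1973HalfIntegral, §1] -/
theorem apply_smul_eq_of_isThetaAutomorphic (hN : 4 ∣ N) {f : ℍ → ℂ} (hf : MDiff f)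
    (ha : IsThetaAutomorphic k N χ f) {γ : SL(2, ℤ)} (hγ : γ ∈ Gamma0 N) (z : ℍ) :
    f (γ • z) = autFactor k N χ γ z * f z := by
  have hGd : MDiff (fun z : ℍ ↦ f (γ • z) - autFactor k N χ γ z * f z) :=
    (mdifferentiable_comp_smul hf γ).sub ((mdifferentiable_autFactor γ).mul hf)
  have h0 := eq_zero_of_mul_shimuraTheta_pow hGd k (fun w ↦ by
    have h1 := ha γ hγ w
    have h2 := shimuraTheta_smul_eq_thetaFactor hN hγ w
    simp only [autFactor]
    rw [sub_mul, h1, h2, mul_pow]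
    ring)
  have := congrFun h0 z
  simp only [Pi.zero_apply, sub_eq_zero] at this
  exact this

/-- Members of `M_{k/2}(N, χ)` satisfy `f(γz) = χ(d) j(γ,z)^k f(z)` on `Γ₀(N)`. [folklore] -/
theorem apply_smul_eq_of_mem (hN : 4 ∣ N) {f : ℍ → ℂ} (hf : f ∈ halfIntModularForms k N χ)
    {γ : SL(2, ℤ)} (hγ : γ ∈ Gamma0 N) (z : ℍ) : f (γ • z) = autFactor k N χ γ z * f z :=
  apply_smul_eq_of_isThetaAutomorphic hN hf.1 hf.2.1 hγ z

/-- Conversely, genuine automorphy gives the multiplied-out automorphy `IsThetaAutomorphic`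
(multiply by `θ(z)^k` and use `θ(γz) = j(γ,z) θ(z)`). [folklore] -/
theorem isThetaAutomorphic_of_apply_smul_eq (hN : 4 ∣ N) {g : ℍ → ℂ}
    (h : ∀ γ ∈ Gamma0 N, ∀ z : ℍ, g (γ • z) = autFactor k N χ γ z * g z) :
    IsThetaAutomorphic k N χ g := by
  intro γ hγ z
  rw [h γ hγ z, shimuraTheta_smul_eq_thetaFactor hN hγ z, mul_pow]
  simp only [autFactor]
  ring

/-! ### The abstract trace: automorphy of `Σ_i χ(d_i)⁻¹ j(δ_i, z)^{-k} F(δ_i z)` -/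

/-- The upper-right entries compose: `(xy⁻¹)_{01} = -x_{00} y_{01} + x_{01} y_{00}`, so
`{η : M ∣ η_{01}}` is closed under `(x, y) ↦ x y⁻¹`. [folklore] -/
theorem dvd_mul_inv_apply_01 {M : ℤ} {x y : SL(2, ℤ)} (hx : M ∣ x 0 1) (hy : M ∣ y 0 1) :
    M ∣ (x * y⁻¹) 0 1 := by
  have : (x * y⁻¹) 0 1 = -(x 0 0 * y 0 1) + x 0 1 * y 0 0 := by
    simp [Matrix.SpecialLinearGroup.coe_inv, Matrix.adjugate_fin_two, Matrix.mul_apply,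
      Fin.sum_univ_two]
  rw [this]
  exact dvd_add (dvd_neg.mpr (dvd_mul_of_dvd_right hy _)) (dvd_mul_of_dvd_left hx _)

/-- **The trace is automorphic.** Let `δ : ι → Γ₀(N)` be a finite family which is a
transversal of `Γ' \ Γ₀(N)`, `Γ' = {η ∈ Γ₀(N) : M ∣ b_η}`, in the sense of (T1) every
`γ ∈ Γ₀(N)` has some `γ δ_i⁻¹ ∈ Γ'` and (T2) `δ_i δ_j⁻¹ ∈ Γ'` only for `i = j`; and let `F`
satisfy `F(ηz) = χ(d_η) j(η,z)^k F(z)` for `η ∈ Γ'`. Then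
`Tr F(z) = Σ_i (χ(d_i) j(δ_i,z)^k)⁻¹ F(δ_i z)` satisfies `Tr F(γz) = χ(d) j(γ,z)^k Tr F(z)` for
all `γ ∈ Γ₀(N)`: right multiplication by `γ` permutes the cosets, and the cocycle relation
moves the factors (Shimura 1973, §1, the double coset formalism behind Thm. 1.7).
[cite: Shimura1973HalfIntegral, §1] -/
theorem trace_smul (hN : 4 ∣ N) (M : ℤ) {ι : Type*} [Fintype ι] (δ : ι → SL(2, ℤ))
    (hδ : ∀ i, δ i ∈ Gamma0 N)
    (hT1 : ∀ γ ∈ Gamma0 N, ∃ i, M ∣ (γ * (δ i)⁻¹) 0 1)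
    (hT2 : ∀ i j, M ∣ (δ i * (δ j)⁻¹) 0 1 → i = j)
    (F : ℍ → ℂ) (hF : ∀ η ∈ Gamma0 N, M ∣ η 0 1 → ∀ z : ℍ, F (η • z) = autFactor k N χ η z * F z)
    {γ : SL(2, ℤ)} (hγ : γ ∈ Gamma0 N) (z : ℍ) :
    (∑ i, (autFactor k N χ (δ i) (γ • z))⁻¹ * F (δ i • γ • z)) =
      autFactor k N χ γ z * ∑ i, (autFactor k N χ (δ i) z)⁻¹ * F (δ i • z) := by
  classical
  -- the permutation `i ↦ j i` with `δ_i γ = η_i δ_{j i}`, `η_i ∈ Γ'`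
  have hmem : ∀ i, δ i * γ ∈ Gamma0 N := fun i ↦ mul_mem (hδ i) hγ
  choose j hj using fun i ↦ hT1 (δ i * γ) (hmem i)
  set η : ι → SL(2, ℤ) := fun i ↦ δ i * γ * (δ (j i))⁻¹ with hη
  have hηmem : ∀ i, η i ∈ Gamma0 N := fun i ↦ mul_mem (hmem i) (inv_mem (hδ _))
  have hηΓ' : ∀ i, M ∣ (η i) 0 1 := hj
  have hfac : ∀ i, δ i * γ = η i * δ (j i) := fun i ↦ by rw [hη]; group
  -- `j` is injective by (T2), hence a bijection of the finite type `ι`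
  have hinj : Function.Injective j := by
    intro i₁ i₂ h12
    apply hT2
    have h := dvd_mul_inv_apply_01 (hηΓ' i₁) (hηΓ' i₂)
    have : η i₁ * (η i₂)⁻¹ = δ i₁ * (δ i₂)⁻¹ := by
      rw [hη]
      simp only [h12, mul_inv_rev, inv_inv]
      group
    rwa [this] at h
  have hbij : Function.Bijective j := Finite.injective_iff_bijective.mp hinj
  -- termwise identity
  have hterm : ∀ i, (autFactor k N χ (δ i) (γ • z))⁻¹ * F (δ i • γ • z) =
      autFactor k N χ γ z * ((autFactor k N χ (δ (j i)) z)⁻¹ * F (δ (j i) • z)) := by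
    intro i
    have hF' : F (δ i • γ • z) = autFactor k N χ (η i) (δ (j i) • z) * F (δ (j i) • z) := by
      rw [← mul_smul, hfac i, mul_smul]
      exact hF (η i) (hηmem i) (hηΓ' i) _
    -- cocycle: `a(δ_i γ) = a(δ_i)(γz) a(γ) = a(η_i)(δ_j z) a(δ_j)`
    have hc1 := autFactor_mul (k := k) (χ := χ) hN (hδ i) hγ z
    have hc2 := autFactor_mul (k := k) (χ := χ) hN (hηmem i) (hδ (j i)) z
    rw [hfac i] at hc1
    rw [hc1] at hc2
    -- now `a(δ_i)(γz) a(γ) = a(η_i)(δ_j z) a(δ_j)`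
    have hγ0 := autFactor_ne_zero (k := k) (χ := χ) hγ z
    have hη0 := autFactor_ne_zero (k := k) (χ := χ) (hηmem i) (δ (j i) • z)
    have hδ0 := autFactor_ne_zero (k := k) (χ := χ) (hδ (j i)) z
    have hX : autFactor k N χ (δ i) (γ • z) =
        autFactor k N χ (η i) (δ (j i) • z) * autFactor k N χ (δ (j i)) z /
          autFactor k N χ γ z := by
      rw [eq_div_iff hγ0]; exact hc2
    rw [hF', hX]
    field_simp
  simp_rw [hterm]
  rw [← Finset.mul_sum]
  congr 1
  exact Fintype.sum_bijective j hbij _ _ (fun _ ↦ rfl)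

end HeckeA

/-! ## Part 4. The points `z/p²`, `p²z`, `(z + b)/p²`; conjugation by `diag(1, p²)`;
the transversals of `Γ' \ Γ₀(N)`, `Γ' = Γ₀(N) ∩ {p² ∣ b}` -/

section HeckeB

open scoped Manifold

variable {k N : ℕ} {χ : DirichletCharacter ℂ N} {p : ℕ} [Fact p.Prime]

/-- `p ≠ 0` in `ℂ`. [folklore] -/
theorem natCast_p_ne_zero : (p : ℂ) ≠ 0 := by exact_mod_cast (Fact.out : p.Prime).ne_zero

variable (p) in
/-- The point `z/p²`. [folklore] -/
def divPSq (z : ℍ) : ℍ :=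
  ⟨(z : ℂ) / (p : ℂ) ^ 2, by
    rw [show (z : ℂ) / (p : ℂ) ^ 2 = (((p : ℝ) ^ 2)⁻¹ : ℝ) * (z : ℂ) by push_cast; ring,
      Complex.im_ofReal_mul]
    exact mul_pos (inv_pos.mpr (pow_pos (by exact_mod_cast (Fact.out : p.Prime).pos) 2)) z.2⟩

variable (p) in
/-- The point `p² z`. [folklore] -/
def mulPSq (z : ℍ) : ℍ :=
  ⟨(p : ℂ) ^ 2 * z, by
    rw [show (p : ℂ) ^ 2 * (z : ℂ) = (((p : ℝ) ^ 2 : ℝ)) * (z : ℂ) by push_cast; ring,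
      Complex.im_ofReal_mul]
    exact mul_pos (pow_pos (by exact_mod_cast (Fact.out : p.Prime).pos) 2) z.2⟩

variable (p) in
/-- The point `(z + b)/p²` for `b mod p²` (represented by `b.val`). [folklore] -/
def transDiv (b : ZMod (p ^ 2)) (z : ℍ) : ℍ := divPSq p ((((b.val : ℕ) : ℝ)) +ᵥ z)

/-- `divPSq p z = z/p²`. [folklore] -/
@[simp] theorem coe_divPSq (z : ℍ) : ((divPSq p z : ℍ) : ℂ) = (z : ℂ) / (p : ℂ) ^ 2 := rfl

/-- `mulPSq p z = p² z`. [folklore] -/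
@[simp] theorem coe_mulPSq (z : ℍ) : ((mulPSq p z : ℍ) : ℂ) = (p : ℂ) ^ 2 * z := rfl

/-- `transDiv p b z = (z + b)/p²`. [folklore] -/
theorem coe_transDiv (b : ZMod (p ^ 2)) (z : ℍ) :
    ((transDiv p b z : ℍ) : ℂ) = ((z : ℂ) + (b.val : ℂ)) / (p : ℂ) ^ 2 := by
  rw [transDiv, coe_divPSq, coe_vadd]
  push_cast
  ring

/-- `(Tᵐ z)/p² = (z + m)/p²`: `divPSq p (T^{b} • z) = transDiv p b z`. [folklore] -/
theorem divPSq_T_zpow_smul (b : ZMod (p ^ 2)) (z : ℍ) :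
    divPSq p (ModularGroup.T ^ (b.val : ℤ) • z) = transDiv p b z := by
  apply UpperHalfPlane.ext
  rw [coe_divPSq, coe_transDiv, modular_T_zpow_smul, coe_vadd]
  push_cast
  ring

omit [Fact p.Prime] in
/-- `cz + d ≠ 0` on `ℍ` for coprime integers `c, d` (not both zero). [folklore] -/
theorem intLinear_ne_zero {c d : ℤ} (h : Int.gcd c d = 1) (z : ℍ) : (c : ℂ) * z + d ≠ 0 := by
  have hne : ((![(c : ℝ), (d : ℝ)] 0 : ℝ) : ℂ) * z + (![(c : ℝ), (d : ℝ)] 1 : ℝ) ≠ 0 := by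
    apply UpperHalfPlane.linear_ne_zero
    intro hcd
    have hc : (c : ℝ) = 0 := by simpa using congrFun hcd 0
    have hd : (d : ℝ) = 0 := by simpa using congrFun hcd 1
    rw [show c = 0 by exact_mod_cast hc, show d = 0 by exact_mod_cast hd] at h
    simp at h
  simpa using hne

/-! ### Conjugation by `diag(1, p²)`: `(ηz)/p² = η̃ (z/p²)` for `p² ∣ b_η` -/

/-- For `η = (a b; c d) ∈ SL₂(ℤ)` with `p² ∣ b`: `η̃ = (a, b/p²; p²c, d) = αηα⁻¹`,
`α = diag(1, p²)`. [folklore] -/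
def conjPSq (η : SL(2, ℤ)) (h : ((p : ℤ) ^ 2) ∣ η 0 1) : SL(2, ℤ) :=
  ⟨!![η 0 0, η 0 1 / (p : ℤ) ^ 2; (p : ℤ) ^ 2 * η 1 0, η 1 1], by
    rw [Matrix.det_fin_two_of]
    have hdet := det_entries η
    have hb : η 0 1 / (p : ℤ) ^ 2 * ((p : ℤ) ^ 2 * η 1 0) = η 0 1 * η 1 0 := by
      rw [← mul_assoc, Int.ediv_mul_cancel h]
    rw [hb]
    linear_combination hdet⟩

omit [Fact p.Prime] in
/-- Entries of `η̃`. [folklore] -/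
theorem conjPSq_apply (η : SL(2, ℤ)) (h : ((p : ℤ) ^ 2) ∣ η 0 1) :
    (conjPSq η h) 0 0 = η 0 0 ∧ (conjPSq η h) 0 1 * (p : ℤ) ^ 2 = η 0 1 ∧
      (conjPSq η h) 1 0 = (p : ℤ) ^ 2 * η 1 0 ∧ (conjPSq η h) 1 1 = η 1 1 := by
  refine ⟨rfl, ?_, rfl, rfl⟩
  show η 0 1 / (p : ℤ) ^ 2 * (p : ℤ) ^ 2 = η 0 1
  exact Int.ediv_mul_cancel h

omit [Fact p.Prime] in
/-- `η̃ ∈ Γ₀(N)` when `η ∈ Γ₀(N)`. [folklore] -/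
theorem conjPSq_mem {η : SL(2, ℤ)} (hη : η ∈ Gamma0 N) (h : ((p : ℤ) ^ 2) ∣ η 0 1) :
    conjPSq η h ∈ Gamma0 N := by
  rw [Gamma0_mem] at hη ⊢
  rw [(conjPSq_apply η h).2.2.1, Int.cast_mul, hη, mul_zero]

/-- `(ηz)/p² = η̃ (z/p²)`. [folklore] -/
theorem divPSq_smul (η : SL(2, ℤ)) (h : ((p : ℤ) ^ 2) ∣ η 0 1) (z : ℍ) :
    divPSq p (η • z) = conjPSq η h • divPSq p z := by
  obtain ⟨h00, h01, h10, h11⟩ := conjPSq_apply η h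
  apply UpperHalfPlane.ext
  rw [coe_divPSq, coe_specialLinearGroup_apply, coe_specialLinearGroup_apply, coe_divPSq]
  simp only [h00, h10, h11, eq_intCast]
  have hb : ((conjPSq η h 0 1 : ℤ) : ℂ) = ((η 0 1 : ℤ) : ℂ) / (p : ℂ) ^ 2 := by
    rw [eq_div_iff (pow_ne_zero 2 natCast_p_ne_zero)]
    exact_mod_cast h01
  push_cast
  rw [hb]
  have hp := (natCast_p_ne_zero (p := p))
  have hden : ((η 1 0 : ℤ) : ℂ) * z + ((η 1 1 : ℤ) : ℂ) ≠ 0 :=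
    intLinear_ne_zero (gcd_c_d_eq_one η) z
  field_simp

/-- `(m²c / d) = (c/d)` for `gcd(m, d) = 1`. [folklore] -/
theorem shimuraSymbol_sq_mul_left {m c d : ℤ} (hm : m ≠ 0) (hmd : Int.gcd m d = 1) :
    shimuraSymbol (m ^ 2 * c) d = shimuraSymbol c d := by
  unfold shimuraSymbol
  have hsign : (m ^ 2 * c < 0 ∧ d < 0) ↔ (c < 0 ∧ d < 0) := by
    have : 0 < m ^ 2 := by positivity
    constructor
    · rintro ⟨h1, h2⟩; exact ⟨by nlinarith, h2⟩
    · rintro ⟨h1, h2⟩; exact ⟨by nlinarith, h2⟩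
  rw [if_congr hsign rfl rfl, jacobiSym.mul_left, jacobiSym.sq_one' (by
    simpa [Int.gcd, Int.natAbs_abs] using hmd), one_mul]

omit [Fact p.Prime] in
/-- `gcd(p, d) = 1` for the conjugate `η̃` (as `gcd(p²c, d) = 1`). [folklore] -/
theorem gcd_p_d_eq_one (η : SL(2, ℤ)) (h : ((p : ℤ) ^ 2) ∣ η 0 1) :
    Int.gcd (p : ℤ) (η 1 1) = 1 := by
  have h1 := gcd_c_d_eq_one (conjPSq η h)
  rw [(conjPSq_apply η h).2.2.1, (conjPSq_apply η h).2.2.2] at h1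
  rw [← Int.isCoprime_iff_gcd_eq_one] at h1 ⊢
  rw [sq, mul_assoc] at h1
  exact h1.of_mul_left_left

/-- **`j` is compatible with conjugation by `diag(1, p²)`**: `χ(d) j(η̃, z/p²)^k = χ(d) j(η, z)^k`
(`ε_d` and `√(p²c · z/p² + d) = √(cz + d)` unchanged, `(p²c/d) = (c/d)` as `p ∤ d`).
[cite: Shimura1973HalfIntegral, §1] -/
theorem autFactor_conjPSq (η : SL(2, ℤ)) (h : ((p : ℤ) ^ 2) ∣ η 0 1) (z : ℍ) :
    autFactor k N χ (conjPSq η h) (divPSq p z) = autFactor k N χ η z := by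
  obtain ⟨-, -, h10, h11⟩ := conjPSq_apply η h
  unfold autFactor thetaFactor
  rw [h10, h11, shimuraSymbol_sq_mul_left (by exact_mod_cast (Fact.out : p.Prime).ne_zero)
    (gcd_p_d_eq_one η h), coe_divPSq]
  congr 3
  push_cast
  field_simp [natCast_p_ne_zero (p := p)]

/-- **Partial automorphy of `F(z) = f(z/p²)`**: for `f` automorphic on `Γ₀(N)` and
`η ∈ Γ' = Γ₀(N) ∩ {p² ∣ b}`, `F(ηz) = χ(d) j(η, z)^k F(z)`. [cite: Shimura1973HalfIntegral, §1] -/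
theorem apply_divPSq_smul {f : ℍ → ℂ}
    (hf : ∀ γ ∈ Gamma0 N, ∀ z : ℍ, f (γ • z) = autFactor k N χ γ z * f z)
    {η : SL(2, ℤ)} (hη : η ∈ Gamma0 N) (h : ((p : ℤ) ^ 2) ∣ η 0 1) (z : ℍ) :
    f (divPSq p (η • z)) = autFactor k N χ η z * f (divPSq p z) := by
  rw [divPSq_smul η h, hf _ (conjPSq_mem hη h), autFactor_conjPSq]

/-! ### The transversal `{Tᵇ : b mod p²}` (case `p ∣ N`) -/

/-- Upper-right entry of `γ T^{-m}`: `b - a m`. [folklore] -/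
theorem mul_T_zpow_neg_apply_01 (γ : SL(2, ℤ)) (m : ℤ) :
    (γ * (ModularGroup.T ^ m)⁻¹) 0 1 = γ 0 1 - γ 0 0 * m := by
  rw [← zpow_neg]
  simp [Matrix.mul_apply, Fin.sum_univ_two, ModularGroup.coe_T_zpow]
  ring

/-- An integer coprime to `n` is a unit modulo `n`. [folklore] -/
theorem isUnit_intCast_of_isCoprime {n : ℕ} {a : ℤ} (h : IsCoprime a n) : IsUnit (a : ZMod n) := by
  obtain ⟨u, v, huv⟩ := h
  refine IsUnit.of_mul_eq_one (u : ZMod n) ?_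
  have := congrArg (fun x : ℤ ↦ (x : ZMod n)) huv
  simp only [Int.cast_add, Int.cast_mul, Int.cast_natCast, ZMod.natCast_self, mul_zero, add_zero,
    Int.cast_one] at this
  rw [mul_comm]
  exact this

/-- `p ∤ a` makes `a` a unit modulo `p²`. [folklore] -/
theorem isUnit_intCast_sq_of_not_dvd {a : ℤ} (ha : ¬ (p : ℤ) ∣ a) : IsUnit (a : ZMod (p ^ 2)) := by
  have hp : p.Prime := Fact.out
  apply isUnit_intCast_of_isCoprime
  rw [Int.isCoprime_iff_gcd_eq_one, Int.gcd, Nat.cast_pow, Int.natAbs_pow, Int.natAbs_natCast]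
  apply Nat.Coprime.pow_right
  exact ((Nat.Prime.coprime_iff_not_dvd hp).mpr (fun h ↦ ha (Int.ofNat_dvd_left.mpr h))).symm

/-- `p ∤ a` makes `a` a unit modulo `p`. [folklore] -/
theorem isUnit_intCast_of_not_dvd {a : ℤ} (ha : ¬ (p : ℤ) ∣ a) : IsUnit (a : ZMod p) := by
  have hp : p.Prime := Fact.out
  apply isUnit_intCast_of_isCoprime
  rw [Int.isCoprime_iff_gcd_eq_one, Int.gcd, Int.natAbs_natCast]
  exact ((Nat.Prime.coprime_iff_not_dvd hp).mpr (fun h ↦ ha (Int.ofNat_dvd_left.mpr h))).symm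

omit [Fact p.Prime] in
/-- `p² ∣ x` iff `x ≡ 0` in `ℤ/p²`. [folklore] -/
theorem sq_dvd_iff_cast_eq_zero (x : ℤ) : ((p : ℤ) ^ 2) ∣ x ↔ (x : ZMod (p ^ 2)) = 0 := by
  rw [ZMod.intCast_zmod_eq_zero_iff_dvd, Nat.cast_pow]

/-- **(T1) for the family `Tᵇ`** when `p ∤ a_γ`: `γ T^{-b} ∈ Γ'` for `b ≡ b_γ a_γ⁻¹ (mod p²)`.
[folklore] -/
theorem exists_T_zpow_of_not_dvd {γ : SL(2, ℤ)} (ha : ¬ (p : ℤ) ∣ γ 0 0) :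
    ∃ b : ZMod (p ^ 2), ((p : ℤ) ^ 2) ∣ (γ * (ModularGroup.T ^ (b.val : ℤ))⁻¹) 0 1 := by
  obtain ⟨u, hu⟩ := isUnit_intCast_sq_of_not_dvd ha
  refine ⟨((γ 0 1 : ℤ) : ZMod (p ^ 2)) * (u⁻¹ : (ZMod (p ^ 2))ˣ), ?_⟩
  rw [mul_T_zpow_neg_apply_01, sq_dvd_iff_cast_eq_zero]
  push_cast
  rw [ZMod.natCast_zmod_val, ← hu, ← mul_assoc, mul_comm (u : ZMod (p ^ 2)), mul_assoc,
    Units.mul_inv, mul_one, sub_self]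

/-- **(T2) for the family `Tᵇ`**: `Tᵇ T^{-b'} ∈ Γ'` forces `b = b'`. [folklore] -/
theorem T_zpow_eq_of_dvd {b b' : ZMod (p ^ 2)}
    (h : ((p : ℤ) ^ 2) ∣ (ModularGroup.T ^ (b.val : ℤ) * (ModularGroup.T ^ (b'.val : ℤ))⁻¹) 0 1) :
    b = b' := by
  rw [mul_T_zpow_neg_apply_01, ModularGroup.coe_T_zpow, sq_dvd_iff_cast_eq_zero] at h
  simp only [Matrix.of_apply, Matrix.cons_val', Matrix.cons_val_one, Matrix.cons_val_fin_one,
    Matrix.cons_val_zero, one_mul] at h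
  push_cast at h
  rw [ZMod.natCast_zmod_val, ZMod.natCast_zmod_val, sub_eq_zero] at h
  exact h

/-- `p ∤ a_γ` for `γ ∈ Γ₀(N)` when `p ∣ N` (including `N = 0`): `ad - bc = 1` with `p ∣ c`.
[folklore] -/
theorem not_dvd_a_of_dvd {γ : SL(2, ℤ)} (hγ : γ ∈ Gamma0 N) (hpN : p ∣ N) : ¬ (p : ℤ) ∣ γ 0 0 := by
  intro ha
  have hdet := det_entries γ
  rw [Gamma0_mem, ZMod.intCast_zmod_eq_zero_iff_dvd] at hγ
  have hc : (p : ℤ) ∣ γ 1 0 := dvd_trans (Int.natCast_dvd_natCast.mpr hpN) hγ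
  have h1 : (p : ℤ) ∣ γ 0 0 * γ 1 1 - γ 0 1 * γ 1 0 :=
    dvd_sub (dvd_mul_of_dvd_left ha _) (dvd_mul_of_dvd_right hc _)
  rw [hdet] at h1
  exact (Fact.out : p.Prime).not_dvd_one (Int.ofNat_dvd.mp h1)

/-- `χ(1) j(Tᵇ, z)^k = 1`. [folklore] -/
theorem autFactor_T_zpow (m : ℤ) (z : ℍ) : autFactor k N χ (ModularGroup.T ^ m) z = 1 := by
  unfold autFactor thetaFactor thetaEps shimuraSymbol
  simp [ModularGroup.coe_T_zpow]

/-! ### A Jacobi-symbol identity for the non-upper-triangular representatives -/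

/-- **Reciprocity step**: for an odd prime `p`, `h ∈ [1, p)`, `4 ∣ u`, and the odd integer
`D = p - h u`: `(h / |D|) = (h / p)`. Split `h = 2^e h₁`; for the odd part use reciprocity twice
(`(h₁/|D|) = ±(D/h₁) = ±(p/h₁) = ±±(h₁/p)`, the signs cancelling because `D ≡ p (mod 4)`), for
the power of `2` use `D ≡ p (mod 8)` when `h` is even. [folklore] -/
theorem jacobiSym_natAbs_sub_eq {h : ℕ} (hh0 : h ≠ 0) (hp2 : p ≠ 2) {u : ℤ} (hu : 4 ∣ u) :
    J(h | ((p : ℤ) - h * u).natAbs) = J(h | p) := by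
  have hp : p.Prime := Fact.out
  have hpodd : Odd (p : ℤ) := by
    have := hp.eq_two_or_odd.resolve_left hp2
    exact (Int.odd_coe_nat p).mpr (Nat.odd_iff.mpr this)
  obtain ⟨e, h₁, hh₁, rfl⟩ := Nat.exists_eq_two_pow_mul_odd hh0
  set D : ℤ := (p : ℤ) - ((2 ^ e * h₁ : ℕ) : ℤ) * u with hD
  have hDodd : Odd D := by
    rw [hD]
    apply hpodd.sub_even
    obtain ⟨v, rfl⟩ := hu
    exact ⟨((2 ^ e * h₁ : ℕ) : ℤ) * (2 * v), by ring⟩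
  have hDn : Odd D.natAbs := Int.natAbs_odd.mpr hDodd
  have hD4 : D % 4 = (p : ℤ) % 4 := by
    have h4 : (4 : ℤ) ∣ ((2 ^ e * h₁ : ℕ) : ℤ) * u := dvd_mul_of_dvd_right hu _
    rw [hD]; omega
  -- the odd part
  have hodd : J((h₁ : ℤ) | D.natAbs) = J((h₁ : ℤ) | p) := by
    have hsw := jacobiSym_swap hh₁ hDodd        -- `J(D | h₁) = recipSign h₁ D * J(h₁ | |D|)`
    have hmod : J(D | h₁) = J((p : ℤ) | h₁) := by
      apply jacobiSym.mod_left'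
      rw [hD, Nat.cast_mul, Nat.cast_pow]
      push_cast
      rw [show (p : ℤ) - 2 ^ e * (h₁ : ℤ) * u = (p : ℤ) + (-(2 ^ e * u)) * h₁ by ring,
        Int.add_mul_emod_self_right]
    have hrec : J((p : ℤ) | h₁) = recipSign h₁ p * J((h₁ : ℤ) | p) := by
      have := jacobiSym_swap hh₁ hpodd
      rwa [Int.natAbs_natCast] at this
    -- combine: `J(h₁ | |D|) = recipSign h₁ D * J(D|h₁)` (recipSign² = 1)
    have h1 : J((h₁ : ℤ) | D.natAbs) = recipSign h₁ D * J(D | h₁) := by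
      rw [hsw, ← mul_assoc, recipSign_mul_self, one_mul]
    rw [h1, hmod, hrec, ← mul_assoc, show recipSign h₁ D = recipSign h₁ p by
      unfold recipSign; rw [hD4], recipSign_mul_self, one_mul]
  -- the power of two
  rcases Nat.eq_zero_or_pos e with rfl | he
  · simpa using hodd
  · have hD8 : (D : ZMod 8) = (p : ZMod 8) := by
      rw [hD]
      obtain ⟨v, rfl⟩ := hu
      obtain ⟨e', rfl⟩ : ∃ e', e = e' + 1 := ⟨e - 1, by omega⟩
      push_cast
      rw [sub_eq_self]
      have : ((2 : ZMod 8) ^ (e' + 1) * (h₁ : ZMod 8) * (4 * (v : ZMod 8))) =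
          8 * (2 ^ e' * h₁ * v) := by ring
      rw [this, show (8 : ZMod 8) = 0 from rfl, zero_mul]
    have hpn : Odd p := Nat.odd_iff.mpr (hp.eq_two_or_odd.resolve_left hp2)
    rw [Nat.cast_mul, Nat.cast_pow, jacobiSym.mul_left, jacobiSym.mul_left, jacobiSym.pow_left,
      jacobiSym.pow_left, Nat.cast_ofNat, jacobiSym.at_two hDn, jacobiSym.at_two hpn, hodd,
      χ₈_natAbs, hD8]

end HeckeB

section HeckeB2

open scoped Manifold

variable {k N : ℕ} {χ : DirichletCharacter ℂ N} {p : ℕ} [Fact p.Prime]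

/-! ### `√(rX) = √r √X` for `r ≥ 0` -/

/-- `√(rX) = √r · √X` for real `r ≥ 0` (the argument is unchanged). [folklore] -/
theorem csqrt_ofReal_mul' {r : ℝ} (hr : 0 ≤ r) (X : ℂ) :
    Complex.sqrt ((r : ℂ) * X) = (Real.sqrt r : ℂ) * Complex.sqrt X := by
  rcases hr.eq_or_lt with rfl | hr
  · simp
  apply csqrt_eq_of_sq_eq'
  · rw [mul_pow, csqrt_sq, ← Complex.ofReal_pow, Real.sq_sqrt hr.le]
  · have hs : 0 < Real.sqrt r := Real.sqrt_pos.mpr hr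
    have hre := csqrt_re_nonneg X
    rcases hre.eq_or_lt with h0 | hpos
    · right
      have him := csqrt_im_nonneg_of_re_eq_zero h0.symm
      constructor
      · rw [Complex.re_ofReal_mul, ← h0, mul_zero]
      · rw [Complex.im_ofReal_mul]; exact mul_nonneg hs.le him
    · left
      rw [Complex.re_ofReal_mul]; exact mul_pos hs hpos

omit [Fact p.Prime] in
/-- `√(p X) = √p √X`. [folklore] -/
theorem csqrt_p_mul (X : ℂ) : Complex.sqrt ((p : ℂ) * X) = (Real.sqrt p : ℂ) * Complex.sqrt X := by
  have := csqrt_ofReal_mul' (r := (p : ℝ)) (Nat.cast_nonneg p) X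
  push_cast at this
  exact this

omit [Fact p.Prime] in
/-- `√(p² X) = p √X`. [folklore] -/
theorem csqrt_p_sq_mul (X : ℂ) : Complex.sqrt ((p : ℂ) ^ 2 * X) = (p : ℂ) * Complex.sqrt X := by
  have := csqrt_ofReal_mul' (r := (p : ℝ) ^ 2) (by positivity) X
  rw [Real.sqrt_sq (Nat.cast_nonneg p)] at this
  push_cast at this
  exact this

/-! ### The representatives `γ_s = (1 + u_s, 1; u_s, 1)`, `s mod p` (case `p ∤ N`) -/

omit [Fact p.Prime] in
/-- `N` and `p²` are coprime when `p ∤ N`. [folklore] -/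
theorem coprime_N_sq (hp : p.Prime) (hpN : ¬ p ∣ N) : Nat.Coprime N (p ^ 2) :=
  (Nat.Coprime.pow_left 2 ((Nat.Prime.coprime_iff_not_dvd hp).mpr hpN)).symm

variable (N) in
/-- **`u_s`**: a natural number with `N ∣ u_s` and `u_s ≡ ps - 1 (mod p²)` (Chinese remainder
theorem; `p ∤ N`). [folklore] -/
def traceU (hpN : ¬ p ∣ N) (s : ZMod p) : ℕ :=
  (Nat.chineseRemainder (coprime_N_sq (Fact.out : p.Prime) hpN) 0 (p * s.val + (p ^ 2 - 1))).val

/-- `N ∣ u_s`. [folklore] -/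
theorem N_dvd_traceU (hpN : ¬ p ∣ N) (s : ZMod p) : (N : ℤ) ∣ (traceU N hpN s : ℤ) := by
  have h := (Nat.chineseRemainder (coprime_N_sq (Fact.out : p.Prime) hpN) 0
    (p * s.val + (p ^ 2 - 1))).2.1
  have : N ∣ traceU N hpN s := (Nat.modEq_zero_iff_dvd.mp h)
  exact Int.natCast_dvd_natCast.mpr this

/-- `p² ∣ u_s - (ps - 1)`. [folklore] -/
theorem sq_dvd_traceU_sub (hpN : ¬ p ∣ N) (s : ZMod p) :
    ((p : ℤ) ^ 2) ∣ (traceU N hpN s : ℤ) - ((p : ℤ) * s.val - 1) := by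
  have h := (Nat.chineseRemainder (coprime_N_sq (Fact.out : p.Prime) hpN) 0
    (p * s.val + (p ^ 2 - 1))).2.2
  have h' := (Nat.modEq_iff_dvd.mp h.symm)
  have hp1 : 1 ≤ p ^ 2 := Nat.one_le_pow _ _ (Fact.out : p.Prime).pos
  push_cast [Nat.cast_sub hp1] at h'
  have : (traceU N hpN s : ℤ) - ((p : ℤ) * s.val - 1) =
      ((traceU N hpN s : ℤ) - ((p : ℤ) * s.val + ((p : ℤ) ^ 2 - 1))) + (p : ℤ) ^ 2 := by ring
  rw [this]
  exact dvd_add h' (dvd_refl _)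

/-- `p ∣ 1 + u_s`. [folklore] -/
theorem p_dvd_one_add_traceU (hpN : ¬ p ∣ N) (s : ZMod p) :
    (p : ℤ) ∣ 1 + (traceU N hpN s : ℤ) := by
  have h := sq_dvd_traceU_sub hpN s
  have h1 : (p : ℤ) ∣ (traceU N hpN s : ℤ) - ((p : ℤ) * s.val - 1) :=
    dvd_trans (Dvd.intro_left _ (sq (p : ℤ)).symm) h
  have : 1 + (traceU N hpN s : ℤ) = ((traceU N hpN s : ℤ) - ((p : ℤ) * s.val - 1)) + p * s.val := by
    ring
  rw [this]
  exact dvd_add h1 (dvd_mul_right _ _)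

/-- `p ∤ u_s` (`u_s ≡ -1 mod p`). [folklore] -/
theorem not_p_dvd_traceU (hpN : ¬ p ∣ N) (s : ZMod p) : ¬ (p : ℤ) ∣ (traceU N hpN s : ℤ) := by
  intro h
  have := dvd_sub (p_dvd_one_add_traceU hpN s) h
  rw [add_sub_cancel_right] at this
  exact (Fact.out : p.Prime).not_dvd_one (Int.ofNat_dvd.mp this)

/-- `4 ∣ u_s` (as `4 ∣ N ∣ u_s`). [folklore] -/
theorem four_dvd_traceU (hN : 4 ∣ N) (hpN : ¬ p ∣ N) (s : ZMod p) :
    (4 : ℤ) ∣ (traceU N hpN s : ℤ) :=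
  dvd_trans (Int.natCast_dvd_natCast.mpr hN) (N_dvd_traceU hpN s)

variable (N) in
/-- **`γ_s = (1 + u_s, 1; u_s, 1) ∈ Γ₀(N)`**, the representatives of the `p` cosets of
`Γ' \ Γ₀(N)` with top row `(ps : 1)` in `P¹(ℤ/p²)`. [folklore] -/
def gammaS (hpN : ¬ p ∣ N) (s : ZMod p) : SL(2, ℤ) :=
  ⟨!![1 + (traceU N hpN s : ℤ), 1; (traceU N hpN s : ℤ), 1], by
    rw [Matrix.det_fin_two_of]; ring⟩

/-- Entries of `γ_s`. [folklore] -/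
theorem gammaS_apply (hpN : ¬ p ∣ N) (s : ZMod p) :
    (gammaS N hpN s) 0 0 = 1 + (traceU N hpN s : ℤ) ∧ (gammaS N hpN s) 0 1 = 1 ∧
      (gammaS N hpN s) 1 0 = (traceU N hpN s : ℤ) ∧ (gammaS N hpN s) 1 1 = 1 :=
  ⟨rfl, rfl, rfl, rfl⟩

/-- `γ_s ∈ Γ₀(N)`. [folklore] -/
theorem gammaS_mem (hpN : ¬ p ∣ N) (s : ZMod p) : gammaS N hpN s ∈ Gamma0 N := by
  rw [Gamma0_mem, (gammaS_apply hpN s).2.2.1, ZMod.intCast_zmod_eq_zero_iff_dvd]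
  exact N_dvd_traceU hpN s

/-- `χ(1) j(γ_s, z)^k = √(u_s z + 1)^k`. [folklore] -/
theorem autFactor_gammaS (hpN : ¬ p ∣ N) (s : ZMod p) (z : ℍ) :
    autFactor k N χ (gammaS N hpN s) z = Complex.sqrt ((traceU N hpN s : ℂ) * z + 1) ^ k := by
  unfold autFactor thetaFactor thetaEps
  rw [(gammaS_apply hpN s).2.2.1, (gammaS_apply hpN s).2.2.2,
    shimuraSymbol_of_nonneg (Int.natCast_nonneg _)]
  simp

/-! ### (T1), (T2) for the transversal `{Tᵇ} ∪ {γ_s}` -/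

/-- `p ∤ b_γ` when `p ∣ a_γ` (`ad - bc = 1`). [folklore] -/
theorem not_dvd_b_of_dvd_a {γ : SL(2, ℤ)} (ha : (p : ℤ) ∣ γ 0 0) : ¬ (p : ℤ) ∣ γ 0 1 := by
  intro hb
  have hdet := det_entries γ
  have h1 : (p : ℤ) ∣ γ 0 0 * γ 1 1 - γ 0 1 * γ 1 0 :=
    dvd_sub (dvd_mul_of_dvd_left ha _) (dvd_mul_of_dvd_left hb _)
  rw [hdet] at h1
  exact (Fact.out : p.Prime).not_dvd_one (Int.ofNat_dvd.mp h1)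

/-- Upper-right entry of `γ γ_s⁻¹`: `-a + b(1 + u_s)`. [folklore] -/
theorem mul_gammaS_inv_apply_01 (hpN : ¬ p ∣ N) (γ : SL(2, ℤ)) (s : ZMod p) :
    (γ * (gammaS N hpN s)⁻¹) 0 1 = -γ 0 0 + γ 0 1 * (1 + (traceU N hpN s : ℤ)) := by
  simp [Matrix.SpecialLinearGroup.coe_inv, Matrix.adjugate_fin_two, Matrix.mul_apply,
    Fin.sum_univ_two, gammaS]

/-- **(T1), case `p ∣ a_γ`**: `γ γ_s⁻¹ ∈ Γ'` for `s ≡ (a/p) b⁻¹ (mod p)`. [folklore] -/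
theorem exists_gammaS_of_dvd (hpN : ¬ p ∣ N) {γ : SL(2, ℤ)} (ha : (p : ℤ) ∣ γ 0 0) :
    ∃ s : ZMod p, ((p : ℤ) ^ 2) ∣ (γ * (gammaS N hpN s)⁻¹) 0 1 := by
  obtain ⟨a₁, ha₁⟩ := ha
  obtain ⟨w, hw⟩ := isUnit_intCast_of_not_dvd (not_dvd_b_of_dvd_a ⟨a₁, ha₁⟩)
  set s : ZMod p := (a₁ : ZMod p) * (w⁻¹ : (ZMod p)ˣ) with hs
  refine ⟨s, ?_⟩
  rw [mul_gammaS_inv_apply_01]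
  -- `-a + b(1+u) = b (1 + u - p s) + p (b s - a₁)`
  have h1 := sq_dvd_traceU_sub hpN s
  have h2 : (p : ℤ) ∣ γ 0 1 * (s.val : ℤ) - a₁ := by
    rw [← ZMod.intCast_zmod_eq_zero_iff_dvd]
    push_cast
    rw [ZMod.natCast_zmod_val, ← hw, hs, mul_comm (a₁ : ZMod p), ← mul_assoc, Units.mul_inv,
      one_mul, sub_self]
  have : -γ 0 0 + γ 0 1 * (1 + (traceU N hpN s : ℤ)) =
      γ 0 1 * ((traceU N hpN s : ℤ) - ((p : ℤ) * s.val - 1)) + p * (γ 0 1 * (s.val : ℤ) - a₁) := by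
    rw [ha₁]; ring
  rw [this]
  exact dvd_add (dvd_mul_of_dvd_right h1 _) (by rw [sq]; exact mul_dvd_mul_left _ h2)

/-- **(T1)** for the transversal `{Tᵇ} ∪ {γ_s}`. [folklore] -/
theorem exists_rep (hpN : ¬ p ∣ N) (γ : SL(2, ℤ)) :
    ∃ i : ZMod (p ^ 2) ⊕ ZMod p, ((p : ℤ) ^ 2) ∣
      (γ * (Sum.elim (fun b : ZMod (p ^ 2) ↦ ModularGroup.T ^ (b.val : ℤ))
        (fun s ↦ gammaS N hpN s) i)⁻¹) 0 1 := by
  by_cases ha : (p : ℤ) ∣ γ 0 0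
  · obtain ⟨s, hs⟩ := exists_gammaS_of_dvd hpN ha
    exact ⟨Sum.inr s, hs⟩
  · obtain ⟨b, hb⟩ := exists_T_zpow_of_not_dvd ha
    exact ⟨Sum.inl b, hb⟩

/-- `Tᵇ γ_s⁻¹ ∉ Γ'` (its upper-right entry is `≡ -1 mod p`). [folklore] -/
theorem not_sq_dvd_T_mul_gammaS_inv (hpN : ¬ p ∣ N) (b : ZMod (p ^ 2)) (s : ZMod p) :
    ¬ ((p : ℤ) ^ 2) ∣ (ModularGroup.T ^ (b.val : ℤ) * (gammaS N hpN s)⁻¹) 0 1 := by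
  rw [mul_gammaS_inv_apply_01, ModularGroup.coe_T_zpow]
  simp only [Matrix.of_apply, Matrix.cons_val', Matrix.cons_val_zero, Matrix.cons_val_one,
    Matrix.cons_val_fin_one]
  intro h
  have h1 : (p : ℤ) ∣ -1 + (b.val : ℤ) * (1 + (traceU N hpN s : ℤ)) :=
    dvd_trans (Dvd.intro_left _ (sq (p : ℤ)).symm) h
  have h2 : (p : ℤ) ∣ (b.val : ℤ) * (1 + (traceU N hpN s : ℤ)) :=
    dvd_mul_of_dvd_right (p_dvd_one_add_traceU hpN s) _
  have := dvd_sub h2 h1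
  rw [show (b.val : ℤ) * (1 + (traceU N hpN s : ℤ)) -
      (-1 + (b.val : ℤ) * (1 + (traceU N hpN s : ℤ))) = 1 by ring] at this
  exact (Fact.out : p.Prime).not_dvd_one (Int.ofNat_dvd.mp this)

/-- `γ_s T^{-b} ∉ Γ'` (its upper-right entry is `≡ 1 mod p`). [folklore] -/
theorem not_sq_dvd_gammaS_mul_T_inv (hpN : ¬ p ∣ N) (s : ZMod p) (b : ZMod (p ^ 2)) :
    ¬ ((p : ℤ) ^ 2) ∣ (gammaS N hpN s * (ModularGroup.T ^ (b.val : ℤ))⁻¹) 0 1 := by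
  rw [mul_T_zpow_neg_apply_01, (gammaS_apply hpN s).1, (gammaS_apply hpN s).2.1]
  intro h
  have h1 : (p : ℤ) ∣ 1 - (1 + (traceU N hpN s : ℤ)) * (b.val : ℤ) :=
    dvd_trans (Dvd.intro_left _ (sq (p : ℤ)).symm) h
  have h2 : (p : ℤ) ∣ (1 + (traceU N hpN s : ℤ)) * (b.val : ℤ) :=
    dvd_mul_of_dvd_left (p_dvd_one_add_traceU hpN s) _
  have := dvd_add h1 h2
  rw [sub_add_cancel] at this
  exact (Fact.out : p.Prime).not_dvd_one (Int.ofNat_dvd.mp this)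

/-- `γ_s γ_{s'}⁻¹ ∈ Γ'` forces `s = s'` (the entry is `u_{s'} - u_s ≡ p(s' - s) mod p²`).
[folklore] -/
theorem gammaS_eq_of_dvd (hpN : ¬ p ∣ N) {s s' : ZMod p}
    (h : ((p : ℤ) ^ 2) ∣ (gammaS N hpN s * (gammaS N hpN s')⁻¹) 0 1) : s = s' := by
  rw [mul_gammaS_inv_apply_01, (gammaS_apply hpN s).1, (gammaS_apply hpN s).2.1] at h
  have h1 := sq_dvd_traceU_sub hpN s
  have h2 := sq_dvd_traceU_sub hpN s'
  have h3 : ((p : ℤ) ^ 2) ∣ (p : ℤ) * ((s'.val : ℤ) - (s.val : ℤ)) := by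
    have := dvd_add (dvd_sub h2 h1) (dvd_neg.mpr h)
    rw [show (traceU N hpN s' : ℤ) - ((p : ℤ) * s'.val - 1) - ((traceU N hpN s : ℤ) -
      ((p : ℤ) * s.val - 1)) + -(-(1 + (traceU N hpN s : ℤ)) + 1 * (1 + (traceU N hpN s' : ℤ))) =
      -((p : ℤ) * ((s'.val : ℤ) - (s.val : ℤ))) by ring, dvd_neg] at this
    exact this
  have hp0 : (p : ℤ) ≠ 0 := by exact_mod_cast (Fact.out : p.Prime).ne_zero
  rw [sq, mul_dvd_mul_iff_left hp0, ← ZMod.intCast_zmod_eq_zero_iff_dvd] at h3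
  push_cast at h3
  rw [ZMod.natCast_zmod_val, ZMod.natCast_zmod_val, sub_eq_zero] at h3
  exact h3.symm

/-- **(T2)** for the transversal `{Tᵇ} ∪ {γ_s}`. [folklore] -/
theorem rep_eq_of_dvd (hpN : ¬ p ∣ N) (i j : ZMod (p ^ 2) ⊕ ZMod p)
    (h : ((p : ℤ) ^ 2) ∣ ((Sum.elim (fun b : ZMod (p ^ 2) ↦ ModularGroup.T ^ (b.val : ℤ))
        (fun s ↦ gammaS N hpN s) i) * (Sum.elim (fun b : ZMod (p ^ 2) ↦
          ModularGroup.T ^ (b.val : ℤ)) (fun s ↦ gammaS N hpN s) j)⁻¹) 0 1) : i = j := by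
  rcases i with b | s <;> rcases j with b' | s'
  · exact congrArg Sum.inl (T_zpow_eq_of_dvd h)
  · exact absurd h (not_sq_dvd_T_mul_gammaS_inv hpN b s')
  · exact absurd h (not_sq_dvd_gammaS_mul_T_inv hpN s b')
  · exact congrArg Sum.inr (gammaS_eq_of_dvd hpN h)

end HeckeB2

/-! ## Part 5. The cofactors `η_s`, the term-by-term evaluation of the trace, and the
automorphy of `T(p²) f` -/

section HeckeC

open scoped Manifold

variable {k N : ℕ} {χ : DirichletCharacter ℂ N} {p : ℕ} [Fact p.Prime]

/-- `h_s ∈ [0, p)`, the representative of `s⁻¹ (mod p)`. [folklore] -/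
def invVal (s : ZMod p) : ℕ := (s⁻¹ : ZMod p).val

/-- `h_s ≠ 0` for `s ≠ 0`. [folklore] -/
theorem invVal_ne_zero {s : ZMod p} (hs : s ≠ 0) : invVal s ≠ 0 := by
  rw [invVal, ne_eq, ZMod.val_eq_zero]
  exact inv_ne_zero hs

/-- `p ∣ h_s s - 1`. [folklore] -/
theorem p_dvd_invVal_mul_sub {s : ZMod p} (hs : s ≠ 0) :
    (p : ℤ) ∣ (invVal s : ℤ) * (s.val : ℤ) - 1 := by
  rw [← ZMod.intCast_zmod_eq_zero_iff_dvd]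
  push_cast
  rw [invVal, ZMod.natCast_zmod_val, ZMod.natCast_zmod_val, inv_mul_cancel₀ hs, sub_self]

/-- `p² ∣ p - h_s (1 + u_s)` (`h_s(1 + u_s) ≡ h_s p s ≡ p mod p²`). [folklore] -/
theorem sq_dvd_p_sub (hpN : ¬ p ∣ N) {s : ZMod p} (hs : s ≠ 0) :
    ((p : ℤ) ^ 2) ∣ (p : ℤ) - (invVal s : ℤ) * (1 + (traceU N hpN s : ℤ)) := by
  have h1 := sq_dvd_traceU_sub hpN s
  have h2 : ((p : ℤ) ^ 2) ∣ (p : ℤ) * ((invVal s : ℤ) * (s.val : ℤ) - 1) := by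
    rw [sq]; exact mul_dvd_mul_left _ (p_dvd_invVal_mul_sub hs)
  have : (p : ℤ) - (invVal s : ℤ) * (1 + (traceU N hpN s : ℤ)) =
      -((invVal s : ℤ) * ((traceU N hpN s : ℤ) - ((p : ℤ) * s.val - 1))) -
        (p : ℤ) * ((invVal s : ℤ) * (s.val : ℤ) - 1) := by ring
  rw [this]
  exact dvd_sub (dvd_neg.mpr (dvd_mul_of_dvd_right h1 _)) h2

/-- **The cofactor `η_s`** (`s ≢ 0`): `diag(1, p²) γ_s = η_s (p h_s; 0 p)` with
`η_s = ((1 + u_s)/p, (p - h_s(1 + u_s))/p²; p u_s, p - h_s u_s) ∈ Γ₀(N)`. [folklore] -/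
def etaS (hpN : ¬ p ∣ N) (s : ZMod p) (hs : s ≠ 0) : SL(2, ℤ) :=
  ⟨!![(1 + (traceU N hpN s : ℤ)) / p,
      ((p : ℤ) - (invVal s : ℤ) * (1 + (traceU N hpN s : ℤ))) / (p : ℤ) ^ 2;
      (p : ℤ) * (traceU N hpN s : ℤ), (p : ℤ) - (invVal s : ℤ) * (traceU N hpN s : ℤ)], by
    have hp0 : (p : ℤ) ≠ 0 := by exact_mod_cast (Fact.out : p.Prime).ne_zero
    have hX := Int.ediv_mul_cancel (p_dvd_one_add_traceU hpN s)
    have hY := Int.ediv_mul_cancel (sq_dvd_p_sub hpN hs)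
    set X := (1 + (traceU N hpN s : ℤ)) / p
    set Y := ((p : ℤ) - (invVal s : ℤ) * (1 + (traceU N hpN s : ℤ))) / (p : ℤ) ^ 2
    set u := (traceU N hpN s : ℤ)
    set h := (invVal s : ℤ)
    rw [Matrix.det_fin_two_of]
    apply mul_right_cancel₀ hp0
    linear_combination ((p : ℤ) - h * u) * hX - u * hY⟩

/-- Entries of `η_s`. [folklore] -/
theorem etaS_apply (hpN : ¬ p ∣ N) (s : ZMod p) (hs : s ≠ 0) :
    (etaS hpN s hs) 0 0 * (p : ℤ) = 1 + (traceU N hpN s : ℤ) ∧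
    (etaS hpN s hs) 0 1 * (p : ℤ) ^ 2 = (p : ℤ) - (invVal s : ℤ) * (1 + (traceU N hpN s : ℤ)) ∧
    (etaS hpN s hs) 1 0 = (p : ℤ) * (traceU N hpN s : ℤ) ∧
    (etaS hpN s hs) 1 1 = (p : ℤ) - (invVal s : ℤ) * (traceU N hpN s : ℤ) :=
  ⟨Int.ediv_mul_cancel (p_dvd_one_add_traceU hpN s), Int.ediv_mul_cancel (sq_dvd_p_sub hpN hs),
    rfl, rfl⟩

/-- `η_s ∈ Γ₀(N)`. [folklore] -/
theorem etaS_mem (hpN : ¬ p ∣ N) (s : ZMod p) (hs : s ≠ 0) : etaS hpN s hs ∈ Gamma0 N := by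
  rw [Gamma0_mem, (etaS_apply hpN s hs).2.2.1, ZMod.intCast_zmod_eq_zero_iff_dvd]
  exact dvd_mul_of_dvd_right (N_dvd_traceU hpN s) _

/-- **`(γ_s z)/p² = η_s (z + h_s/p)`**. [folklore] -/
theorem divPSq_gammaS_smul (hpN : ¬ p ∣ N) {s : ZMod p} (hs : s ≠ 0) (z : ℍ) :
    divPSq p (gammaS N hpN s • z) =
      etaS hpN s hs • ((((invVal s : ℕ) : ℝ) / (p : ℝ) : ℝ) +ᵥ z) := by
  obtain ⟨hX, hY, h10, h11⟩ := etaS_apply hpN s hs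
  obtain ⟨g00, g01, g10, g11⟩ := gammaS_apply hpN s
  have hp := natCast_p_ne_zero (p := p)
  have hXc : (((etaS hpN s hs) 0 0 : ℤ) : ℂ) = (1 + ((traceU N hpN s : ℕ) : ℂ)) / p := by
    rw [eq_div_iff hp]; exact_mod_cast hX
  have hYc : (((etaS hpN s hs) 0 1 : ℤ) : ℂ) =
      ((p : ℂ) - ((invVal s : ℕ) : ℂ) * (1 + ((traceU N hpN s : ℕ) : ℂ))) / (p : ℂ) ^ 2 := by
    rw [eq_div_iff (pow_ne_zero 2 hp)]; exact_mod_cast hY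
  have hden : ((traceU N hpN s : ℕ) : ℂ) * z + 1 ≠ 0 := by
    have := intLinear_ne_zero (c := (traceU N hpN s : ℤ)) (d := 1) (by simp) z
    simpa using this
  apply UpperHalfPlane.ext
  rw [coe_divPSq, coe_specialLinearGroup_apply, coe_specialLinearGroup_apply, coe_vadd]
  simp only [g00, g01, g10, g11, h10, h11, eq_intCast]
  push_cast
  rw [hXc, hYc]
  have hD : (p : ℂ) * ((traceU N hpN s : ℕ) : ℂ) * (((invVal s : ℕ) : ℂ) / (p : ℂ) + z) +
      ((p : ℂ) - ((invVal s : ℕ) : ℂ) * ((traceU N hpN s : ℕ) : ℂ)) =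
      p * (((traceU N hpN s : ℕ) : ℂ) * z + 1) := by
    field_simp; ring
  rw [hD]
  field_simp
  ring

/-- `gcd(u_s, p - h u_s) = 1` (as `p ∤ u_s`). [folklore] -/
theorem gcd_traceU_sub (hpN : ¬ p ∣ N) (s : ZMod p) (h : ℤ) :
    Int.gcd (traceU N hpN s : ℤ) ((p : ℤ) - h * (traceU N hpN s : ℤ)) = 1 := by
  rw [← Int.isCoprime_iff_gcd_eq_one]
  have hc : IsCoprime (traceU N hpN s : ℤ) (p : ℤ) := by
    rw [Int.isCoprime_iff_gcd_eq_one, Int.gcd_comm, Int.gcd, Int.natAbs_natCast,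
      Int.natAbs_natCast]
    exact (Nat.Prime.coprime_iff_not_dvd (Fact.out : p.Prime)).mpr
      (fun hd ↦ not_p_dvd_traceU hpN s (Int.natCast_dvd_natCast.mpr hd))
  have := hc.add_mul_left_right (-h)
  rwa [show (p : ℤ) + (traceU N hpN s : ℤ) * -h = (p : ℤ) - h * (traceU N hpN s : ℤ) by ring]
    at this

/-- **The symbol of `η_s`**: `(p u_s / (p - h_s u_s)) = (h_s / p)`: modulo `|p - h_s u_s|` one
has `p ≡ h_s u_s`, so `(pu/·) = (h u²/·) = (h/·)`, and `(h / |p - hu|) = (h/p)`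
(`jacobiSym_natAbs_sub_eq`). [folklore] -/
theorem shimuraSymbol_etaS (hN : 4 ∣ N) (hpN : ¬ p ∣ N) {s : ZMod p} (hs : s ≠ 0) :
    shimuraSymbol ((p : ℤ) * (traceU N hpN s : ℤ))
      ((p : ℤ) - (invVal s : ℤ) * (traceU N hpN s : ℤ)) = J((invVal s : ℤ) | p) := by
  have hp2 : p ≠ 2 := fun h2 ↦ hpN (h2 ▸ dvd_trans ⟨2, rfl⟩ hN)
  rw [shimuraSymbol_of_nonneg (by positivity), jacobiSym.mul_left]
  -- `J(p | m) = J(h u | m)` since `m = |p - h u|`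
  have hmod : J((p : ℤ) | ((p : ℤ) - (invVal s : ℤ) * (traceU N hpN s : ℤ)).natAbs) =
      J((invVal s : ℤ) * (traceU N hpN s : ℤ) |
        ((p : ℤ) - (invVal s : ℤ) * (traceU N hpN s : ℤ)).natAbs) := by
    apply jacobiSym.mod_left'
    rw [Int.emod_eq_emod_iff_emod_sub_eq_zero]
    exact Int.emod_eq_zero_of_dvd (Int.natAbs_dvd.mpr (dvd_refl _))
  have hu2 : J((traceU N hpN s : ℤ) | ((p : ℤ) - (invVal s : ℤ) * (traceU N hpN s : ℤ)).natAbs) *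
      J((traceU N hpN s : ℤ) | ((p : ℤ) - (invVal s : ℤ) * (traceU N hpN s : ℤ)).natAbs) = 1 := by
    rw [← sq, jacobiSym.sq_one]
    simpa [Int.gcd, Int.natAbs_abs] using gcd_traceU_sub hpN s (invVal s : ℤ)
  rw [hmod, jacobiSym.mul_left, mul_assoc, hu2, mul_one]
  exact jacobiSym_natAbs_sub_eq (invVal_ne_zero hs) hp2 (four_dvd_traceU hN hpN s)

/-- **The automorphy factor of `η_s` at `z + h_s/p`**:
`χ(p - h u) j(η_s, z + h_s/p)^k = χ(p) (ε_p⁻¹ (h_s/p) √p √(u_s z + 1))^k`. [folklore] -/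
theorem autFactor_etaS (hN : 4 ∣ N) (hpN : ¬ p ∣ N) {s : ZMod p} (hs : s ≠ 0) (z : ℍ) :
    autFactor k N χ (etaS hpN s hs) ((((invVal s : ℕ) : ℝ) / (p : ℝ) : ℝ) +ᵥ z) =
      χ (p : ZMod N) * ((thetaEps p)⁻¹ * (J((invVal s : ℤ) | p) : ℂ) *
        ((Real.sqrt p : ℂ) * Complex.sqrt (((traceU N hpN s : ℕ) : ℂ) * z + 1))) ^ k := by
  obtain ⟨-, -, h10, h11⟩ := etaS_apply hpN s hs
  have hp := natCast_p_ne_zero (p := p)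
  unfold autFactor thetaFactor
  rw [h10, h11, shimuraSymbol_etaS hN hpN hs]
  -- the character: `p - h u ≡ p (mod N)`
  have hχ : ((((p : ℤ) - (invVal s : ℤ) * (traceU N hpN s : ℤ) : ℤ)) : ZMod N) = (p : ZMod N) := by
    have h0 : (((traceU N hpN s : ℕ) : ℤ) : ZMod N) = 0 :=
      (ZMod.intCast_zmod_eq_zero_iff_dvd _ N).mpr (N_dvd_traceU hpN s)
    rw [Int.cast_sub, Int.cast_mul, h0, mul_zero, sub_zero, Int.cast_natCast]
  -- `ε_{p - hu} = ε_p`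
  have hε : thetaEps ((p : ℤ) - (invVal s : ℤ) * (traceU N hpN s : ℤ)) = thetaEps p := by
    apply thetaEps_eq_of_emod_eq
    have h4 : (4 : ℤ) ∣ (invVal s : ℤ) * (traceU N hpN s : ℤ) :=
      dvd_mul_of_dvd_right (four_dvd_traceU hN hpN s) _
    omega
  -- the radicand: `p u (z + h/p) + (p - hu) = p (uz + 1)`
  have hrad : ((((p : ℤ) * (traceU N hpN s : ℤ) : ℤ)) : ℂ) *
      ((((((invVal s : ℕ) : ℝ) / (p : ℝ) : ℝ)) +ᵥ z : ℍ) : ℂ)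
      + ((((p : ℤ) - (invVal s : ℤ) * (traceU N hpN s : ℤ) : ℤ)) : ℂ) =
      (p : ℂ) * (((traceU N hpN s : ℕ) : ℂ) * z + 1) := by
    rw [coe_vadd]; push_cast; field_simp; ring
  rw [hχ, hε, hrad, csqrt_p_mul]

/-- `p² ∣ 1 + u_0`. [folklore] -/
theorem sq_dvd_one_add_traceU_zero (hpN : ¬ p ∣ N) : ((p : ℤ) ^ 2) ∣ 1 + (traceU N hpN 0 : ℤ) := by
  have := sq_dvd_traceU_sub hpN 0
  rw [ZMod.val_zero, Nat.cast_zero, mul_zero, zero_sub, sub_neg_eq_add, add_comm] at this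
  exact this

/-- **The cofactor `η_0`**: `diag(1, p²) γ_0 = η_0 diag(p², 1)`,
`η_0 = ((1 + u_0)/p², 1; u_0, p²) ∈ Γ₀(N)`. [folklore] -/
def etaZ (hpN : ¬ p ∣ N) : SL(2, ℤ) :=
  ⟨!![(1 + (traceU N hpN 0 : ℤ)) / (p : ℤ) ^ 2, 1; (traceU N hpN 0 : ℤ), (p : ℤ) ^ 2], by
    rw [Matrix.det_fin_two_of, Int.ediv_mul_cancel (sq_dvd_one_add_traceU_zero hpN)]
    ring⟩

/-- Entries of `η_0`. [folklore] -/
theorem etaZ_apply (hpN : ¬ p ∣ N) :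
    (etaZ hpN) 0 0 * (p : ℤ) ^ 2 = 1 + (traceU N hpN 0 : ℤ) ∧ (etaZ hpN) 0 1 = 1 ∧
      (etaZ hpN) 1 0 = (traceU N hpN 0 : ℤ) ∧ (etaZ hpN) 1 1 = (p : ℤ) ^ 2 :=
  ⟨Int.ediv_mul_cancel (sq_dvd_one_add_traceU_zero hpN), rfl, rfl, rfl⟩

/-- `η_0 ∈ Γ₀(N)`. [folklore] -/
theorem etaZ_mem (hpN : ¬ p ∣ N) : etaZ hpN ∈ Gamma0 N := by
  rw [Gamma0_mem, (etaZ_apply hpN).2.2.1, ZMod.intCast_zmod_eq_zero_iff_dvd]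
  exact N_dvd_traceU hpN 0

/-- **`(γ_0 z)/p² = η_0 (p² z)`**. [folklore] -/
theorem divPSq_gammaS_zero_smul (hpN : ¬ p ∣ N) (z : ℍ) :
    divPSq p (gammaS N hpN 0 • z) = etaZ hpN • mulPSq p z := by
  obtain ⟨hX, h01, h10, h11⟩ := etaZ_apply hpN
  obtain ⟨g00, g01, g10, g11⟩ := gammaS_apply hpN (0 : ZMod p)
  have hp := natCast_p_ne_zero (p := p)
  have hXc : (((etaZ hpN) 0 0 : ℤ) : ℂ) = (1 + ((traceU N hpN 0 : ℕ) : ℂ)) / (p : ℂ) ^ 2 := by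
    rw [eq_div_iff (pow_ne_zero 2 hp)]; exact_mod_cast hX
  have hden : ((traceU N hpN 0 : ℕ) : ℂ) * z + 1 ≠ 0 := by
    have := intLinear_ne_zero (c := (traceU N hpN 0 : ℤ)) (d := 1) (by simp) z
    simpa using this
  apply UpperHalfPlane.ext
  rw [coe_divPSq, coe_specialLinearGroup_apply, coe_specialLinearGroup_apply, coe_mulPSq]
  simp only [g00, g01, g10, g11, h01, h10, h11, eq_intCast]
  push_cast
  rw [hXc]
  have hD : ((traceU N hpN 0 : ℕ) : ℂ) * ((p : ℂ) ^ 2 * z) + (p : ℂ) ^ 2 =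
      (p : ℂ) ^ 2 * (((traceU N hpN 0 : ℕ) : ℂ) * z + 1) := by ring
  rw [hD]
  field_simp

/-- `p² ≡ 1 (mod 4)` for odd `p`. [folklore] -/
theorem sq_emod_four (hp2 : p ≠ 2) : ((p : ℤ) ^ 2) % 4 = 1 := by
  have hodd : p % 2 = 1 := (Fact.out : p.Prime).eq_two_or_odd.resolve_left hp2
  obtain ⟨m, hm⟩ : ∃ m : ℤ, (p : ℤ) = 2 * m + 1 := ⟨p / 2, by omega⟩
  rw [hm, show (2 * m + 1) ^ 2 = 1 + 4 * (m ^ 2 + m) by ring, Int.add_mul_emod_self_left]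
  norm_num

/-- **The automorphy factor of `η_0` at `p² z`**:
`χ(p²) j(η_0, p²z)^k = χ(p²) (p √(u_0 z + 1))^k`. [folklore] -/
theorem autFactor_etaZ (hN : 4 ∣ N) (hpN : ¬ p ∣ N) (z : ℍ) :
    autFactor k N χ (etaZ hpN) (mulPSq p z) =
      χ ((p : ZMod N) ^ 2) * ((p : ℂ) * Complex.sqrt (((traceU N hpN 0 : ℕ) : ℂ) * z + 1)) ^ k := by
  have hp : p.Prime := Fact.out
  have hp2 : p ≠ 2 := fun h2 ↦ hpN (h2 ▸ dvd_trans ⟨2, rfl⟩ hN)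
  obtain ⟨-, -, h10, h11⟩ := etaZ_apply hpN
  unfold autFactor thetaFactor
  rw [h10, h11]
  have hχ : ((((p : ℤ) ^ 2 : ℤ)) : ZMod N) = (p : ZMod N) ^ 2 := by push_cast; ring
  have hε : thetaEps ((p : ℤ) ^ 2) = 1 := by
    unfold thetaEps; rw [sq_emod_four hp2]; norm_num
  have hsym : shimuraSymbol (traceU N hpN 0 : ℤ) ((p : ℤ) ^ 2) = 1 := by
    rw [shimuraSymbol_of_nonneg (Int.natCast_nonneg _), show ((p : ℤ) ^ 2).natAbs = p * p by
      rw [Int.natAbs_pow, Int.natAbs_natCast, sq], jacobiSym.mul_right]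
    have hg : ((traceU N hpN 0 : ℕ) : ℤ).gcd p = 1 := by
      rw [Int.gcd, Int.natAbs_natCast, Int.natAbs_natCast]
      exact ((Nat.Prime.coprime_iff_not_dvd hp).mpr
        (fun hd ↦ not_p_dvd_traceU hpN 0 (Int.natCast_dvd_natCast.mpr hd))).symm
    rcases jacobiSym.eq_one_or_neg_one hg with h1 | h1 <;> rw [h1] <;> norm_num
  have hrad : ((((traceU N hpN 0 : ℕ) : ℤ) : ℤ) : ℂ) * ((mulPSq p z : ℍ) : ℂ) +
      ((((p : ℤ) ^ 2 : ℤ)) : ℂ) = (p : ℂ) ^ 2 * (((traceU N hpN 0 : ℕ) : ℂ) * z + 1) := by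
    rw [coe_mulPSq]; push_cast; ring
  rw [hχ, hε, hsym, hrad, csqrt_p_sq_mul]
  simp

end HeckeC

/-! ## Part 6. `T(p²) f` as a function on `ℍ` and its automorphy -/

section HeckeD

open scoped Manifold

variable {k N : ℕ} {χ : DirichletCharacter ℂ N} {p : ℕ} [Fact p.Prime]

variable (k χ p) in
/-- **`T(p²) f` as a function**:
`(T(p²) f)(z) = p⁻² [ Σ_{b mod p²} f((z + b)/p²)
  + χ(p) (ε_p⁻¹ √p)^k Σ_{t mod p} (t/p) f(z + t/p) + χ(p²) p^k f(p² z) ]`,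
i.e. `p⁻²` times the trace `Σ_δ χ(d_δ)⁻¹ j(δ, z)^{-k} f((δz)/p²)` over the transversal
`{Tᵇ} ∪ {γ_s}` of `(Γ₀(N) ∩ α⁻¹Γ₀(N)α) \ Γ₀(N)`, `α = diag(1, p²)` (`trace_sum_eq`), which is
Shimura's `f | T(p²)` up to his normalisation (Shimura 1973, Prop. 1.5 and the proof of Thm. 1.7;
Koblitz IV §3, Prop. 13). Its `q`-expansion is `heckeTSq k χ p (qCoeffs f)`
(`qCoeffs_heckeFun`). [cite: Shimura1973HalfIntegral, Thm. 1.7] -/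
def heckeFun (f : ℍ → ℂ) (z : ℍ) : ℂ :=
  ((p : ℂ) ^ 2)⁻¹ * (∑ b : ZMod (p ^ 2), f (transDiv p b z)
    + χ (p : ZMod N) * ((thetaEps p)⁻¹ * (Real.sqrt p : ℂ)) ^ k *
        ∑ t : ZMod p, (J((t.val : ℤ) | p) : ℂ) * f ((((t.val : ℕ) : ℝ) / (p : ℝ) : ℝ) +ᵥ z)
    + χ ((p : ZMod N) ^ 2) * (p : ℂ) ^ k * f (mulPSq p z))

/-- The `Tᵇ`-part of the trace: `Σ_b χ(1)⁻¹ j(Tᵇ, z)^{-k} f((Tᵇz)/p²) = Σ_b f((z + b)/p²)`.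
[folklore] -/
theorem trace_inl_eq (f : ℍ → ℂ) (z : ℍ) :
    (∑ b : ZMod (p ^ 2), (autFactor k N χ (ModularGroup.T ^ (b.val : ℤ)) z)⁻¹ *
      f (divPSq p (ModularGroup.T ^ (b.val : ℤ) • z))) =
      ∑ b : ZMod (p ^ 2), f (transDiv p b z) := by
  refine Finset.sum_congr rfl fun b _ ↦ ?_
  rw [autFactor_T_zpow, inv_one, one_mul, divPSq_T_zpow_smul]

/-- `√(uz + 1) ≠ 0` for `u ≥ 0`. [folklore] -/
theorem csqrt_traceU_ne_zero (u : ℕ) (z : ℍ) : Complex.sqrt ((u : ℂ) * z + 1) ≠ 0 := by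
  intro h0
  have h1 : (u : ℂ) * z + 1 = 0 := by rw [← csqrt_sq ((u : ℂ) * z + 1), h0]; ring
  have := intLinear_ne_zero (c := (u : ℤ)) (d := 1) (by simp) z
  exact this (by simpa using h1)

/-- `(h/p)^k = (h/p)` for `k` odd and `0 < h < p`. [folklore] -/
theorem jacobiSym_pow_odd {h : ℕ} (hh0 : h ≠ 0) (hhp : h < p) (hk : Odd k) :
    ((J((h : ℤ) | p) : ℤ) : ℂ) ^ k = (J((h : ℤ) | p) : ℂ) := by
  have hg : (h : ℤ).gcd p = 1 := by
    rw [Int.gcd_natCast_natCast]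
    exact (Nat.coprime_of_lt_prime hh0 hhp (Fact.out : p.Prime)).symm
  rcases jacobiSym.eq_one_or_neg_one hg with h1 | h1
  · rw [h1]; simp
  · rw [h1]; push_cast; exact hk.neg_one_pow

/-- **The `γ_s`-part of the trace** (`p ∤ N`, `f` automorphic on `Γ₀(N)`):
`Σ_s j(γ_s,z)^{-k} f((γ_s z)/p²) = χ(p)(ε_p⁻¹√p)^k Σ_t (t/p) f(z + t/p) + χ(p²) p^k f(p²z)`
(evaluate each term through `η_s`, then reindex `s ↦ s⁻¹`).
[cite: Shimura1973HalfIntegral, Thm. 1.7] -/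
theorem trace_inr_eq (hN : 4 ∣ N) (hpN : ¬ p ∣ N) (hk : Odd k) {f : ℍ → ℂ}
    (hf : ∀ γ ∈ Gamma0 N, ∀ z : ℍ, f (γ • z) = autFactor k N χ γ z * f z) (z : ℍ) :
    (∑ s : ZMod p, (autFactor k N χ (gammaS N hpN s) z)⁻¹ * f (divPSq p (gammaS N hpN s • z))) =
      χ (p : ZMod N) * ((thetaEps p)⁻¹ * (Real.sqrt p : ℂ)) ^ k *
          ∑ t : ZMod p, (J((t.val : ℤ) | p) : ℂ) * f ((((t.val : ℕ) : ℝ) / (p : ℝ) : ℝ) +ᵥ z)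
        + χ ((p : ZMod N) ^ 2) * (p : ℂ) ^ k * f (mulPSq p z) := by
  have hp : p.Prime := Fact.out
  set A := χ ((p : ZMod N) ^ 2) * (p : ℂ) ^ k * f (mulPSq p z) with hA
  set C := χ (p : ZMod N) * ((thetaEps p)⁻¹ * (Real.sqrt p : ℂ)) ^ k with hC
  -- termwise evaluation
  have hterm : ∀ s : ZMod p,
      (autFactor k N χ (gammaS N hpN s) z)⁻¹ * f (divPSq p (gammaS N hpN s • z)) =
      if s = 0 then A else C * ((J((invVal s : ℤ) | p) : ℂ) *
        f ((((invVal s : ℕ) : ℝ) / (p : ℝ) : ℝ) +ᵥ z)) := by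
    intro s
    split_ifs with hs
    · rw [hs, divPSq_gammaS_zero_smul hpN z, hf _ (etaZ_mem hpN), autFactor_etaZ hN hpN,
        autFactor_gammaS, hA]
      have h0 := csqrt_traceU_ne_zero (traceU N hpN 0) z
      field_simp
      ring
    · rw [divPSq_gammaS_smul hpN hs z, hf _ (etaS_mem hpN s hs), autFactor_etaS hN hpN hs,
        autFactor_gammaS, hC]
      have h0 := csqrt_traceU_ne_zero (traceU N hpN s) z
      have hJ := jacobiSym_pow_odd (p := p) (invVal_ne_zero hs) (ZMod.val_lt _) hk
      rw [show (thetaEps p)⁻¹ * (J((invVal s : ℤ) | p) : ℂ) *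
          ((Real.sqrt p : ℂ) * Complex.sqrt (((traceU N hpN s : ℕ) : ℂ) * z + 1)) =
          ((thetaEps p)⁻¹ * (Real.sqrt p : ℂ)) * (J((invVal s : ℤ) | p) : ℂ) *
            Complex.sqrt (((traceU N hpN s : ℕ) : ℂ) * z + 1) by ring, mul_pow, mul_pow, hJ]
      field_simp
  simp_rw [hterm]
  -- reindex by the involution `s ↦ s⁻¹`
  have hinv : Function.Involutive (fun s : ZMod p ↦ s⁻¹) := fun s ↦ inv_inv s
  rw [← Fintype.sum_equiv hinv.toPerm
    (fun t ↦ if t = 0 then A else C * ((J((t.val : ℤ) | p) : ℂ) *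
      f ((((t.val : ℕ) : ℝ) / (p : ℝ) : ℝ) +ᵥ z))) _ (fun s ↦ by
      simp only [Function.Involutive.coe_toPerm, inv_eq_zero, invVal, inv_inv])]
  -- split off `t = 0`, where `(0/p) = 0`
  rw [← Finset.sum_erase_add _ _ (Finset.mem_univ (0 : ZMod p)), if_pos rfl,
    Finset.sum_congr rfl (fun x hx ↦ if_neg (Finset.ne_of_mem_erase hx)), ← Finset.mul_sum,
    Finset.sum_erase_eq_sub (Finset.mem_univ _), ZMod.val_zero, Nat.cast_zero,
    jacobiSym.zero_left hp.one_lt, Int.cast_zero, zero_mul, sub_zero, add_comm]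

/-- **The trace is `p² · T(p²) f`** (`p ∤ N`). [cite: Shimura1973HalfIntegral, Thm. 1.7] -/
theorem trace_sum_eq (hN : 4 ∣ N) (hpN : ¬ p ∣ N) (hk : Odd k) {f : ℍ → ℂ}
    (hf : ∀ γ ∈ Gamma0 N, ∀ z : ℍ, f (γ • z) = autFactor k N χ γ z * f z) (z : ℍ) :
    (∑ i : ZMod (p ^ 2) ⊕ ZMod p,
      (autFactor k N χ (Sum.elim (fun b : ZMod (p ^ 2) ↦ ModularGroup.T ^ (b.val : ℤ))
        (fun s ↦ gammaS N hpN s) i) z)⁻¹ *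
      f (divPSq p (Sum.elim (fun b : ZMod (p ^ 2) ↦ ModularGroup.T ^ (b.val : ℤ))
        (fun s ↦ gammaS N hpN s) i • z))) = (p : ℂ) ^ 2 * heckeFun k χ p f z := by
  rw [Fintype.sum_sum_type]
  simp only [Sum.elim_inl, Sum.elim_inr]
  rw [trace_inl_eq, trace_inr_eq hN hpN hk hf, heckeFun, ← mul_assoc,
    mul_inv_cancel₀ (pow_ne_zero 2 natCast_p_ne_zero), one_mul, add_assoc]

/-- `χ(p) = 0` when `p ∣ N` (`p` is not a unit modulo `N`; includes `N = 0`). [folklore] -/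
theorem chi_p_eq_zero (hpN : p ∣ N) : χ (p : ZMod N) = 0 := by
  apply MulChar.map_nonunit
  rw [ZMod.isUnit_prime_iff_not_dvd (Fact.out : p.Prime)]
  exact fun h ↦ h hpN

/-- **The trace is `p² · T(p²) f`** (`p ∣ N`: only the `Tᵇ` appear, `χ(p) = 0`).
[cite: Shimura1973HalfIntegral, Thm. 1.7] -/
theorem trace_sum_eq_of_dvd (hpN : p ∣ N) (f : ℍ → ℂ) (z : ℍ) :
    (∑ b : ZMod (p ^ 2), (autFactor k N χ (ModularGroup.T ^ (b.val : ℤ)) z)⁻¹ *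
      f (divPSq p (ModularGroup.T ^ (b.val : ℤ) • z))) = (p : ℂ) ^ 2 * heckeFun k χ p f z := by
  rw [trace_inl_eq, heckeFun, chi_p_eq_zero hpN, map_pow, chi_p_eq_zero hpN, ← mul_assoc,
    mul_inv_cancel₀ (pow_ne_zero 2 natCast_p_ne_zero), one_mul]
  simp

/-- **`T(p²) f` is automorphic**: for `f ∈ M_{k/2}(N, χ)` (`k` odd, `4 ∣ N`) and `γ ∈ Γ₀(N)`,
`(T(p²)f)(γz) = χ(d) j(γ, z)^k (T(p²)f)(z)` — the trace argument `trace_smul` with the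
transversal `{Tᵇ}` (`p ∣ N`) or `{Tᵇ} ∪ {γ_s}` (`p ∤ N`).
[cite: Shimura1973HalfIntegral, Thm. 1.7] -/
theorem heckeFun_smul (hN : 4 ∣ N) (hk : Odd k) {f : ℍ → ℂ} (hf : f ∈ halfIntModularForms k N χ)
    {γ : SL(2, ℤ)} (hγ : γ ∈ Gamma0 N) (z : ℍ) :
    heckeFun k χ p f (γ • z) = autFactor k N χ γ z * heckeFun k χ p f z := by
  have hfa : ∀ γ ∈ Gamma0 N, ∀ z : ℍ, f (γ • z) = autFactor k N χ γ z * f z :=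
    fun γ hγ z ↦ apply_smul_eq_of_mem hN hf hγ z
  have hp2 : (p : ℂ) ^ 2 ≠ 0 := pow_ne_zero 2 natCast_p_ne_zero
  have hF : ∀ η ∈ Gamma0 N, ((p : ℤ) ^ 2) ∣ η 0 1 → ∀ z : ℍ,
      f (divPSq p (η • z)) = autFactor k N χ η z * f (divPSq p z) :=
    fun η hη h z ↦ apply_divPSq_smul hfa hη h z
  by_cases hpN : p ∣ N
  · have htr := trace_smul (k := k) (χ := χ) hN ((p : ℤ) ^ 2)
      (fun b : ZMod (p ^ 2) ↦ ModularGroup.T ^ (b.val : ℤ)) (fun b ↦ T_zpow_mem_Gamma0 N _)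
      (fun γ' hγ' ↦ exists_T_zpow_of_not_dvd (not_dvd_a_of_dvd hγ' hpN))
      (fun b b' h ↦ T_zpow_eq_of_dvd h) (fun z ↦ f (divPSq p z)) hF hγ z
    rw [trace_sum_eq_of_dvd hpN f (γ • z), trace_sum_eq_of_dvd hpN f z] at htr
    apply mul_left_cancel₀ hp2
    rw [htr]; ring
  · have htr := trace_smul (k := k) (χ := χ) hN ((p : ℤ) ^ 2)
      (Sum.elim (fun b : ZMod (p ^ 2) ↦ ModularGroup.T ^ (b.val : ℤ)) (fun s ↦ gammaS N hpN s))
      (fun i ↦ by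
        rcases i with b | s
        · exact T_zpow_mem_Gamma0 N _
        · exact gammaS_mem hpN s)
      (fun γ' _ ↦ exists_rep hpN γ') (rep_eq_of_dvd hpN) (fun z ↦ f (divPSq p z)) hF hγ z
    rw [trace_sum_eq hN hpN hk hfa (γ • z), trace_sum_eq hN hpN hk hfa z] at htr
    apply mul_left_cancel₀ hp2
    rw [htr]; ring

/-- **`T(p²) f` is theta-automorphic** (the multiplied-out automorphy of the definition of
`M_{k/2}(N, χ)`). [cite: Shimura1973HalfIntegral, Thm. 1.7] -/
theorem isThetaAutomorphic_heckeFun (hN : 4 ∣ N) (hk : Odd k) {f : ℍ → ℂ}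
    (hf : f ∈ halfIntModularForms k N χ) : IsThetaAutomorphic k N χ (heckeFun k χ p f) :=
  isThetaAutomorphic_of_apply_smul_eq hN (fun _ hγ z ↦ heckeFun_smul hN hk hf hγ z)

end HeckeD

/-! ## Part 7. The `q`-expansion of `T(p²) f` -/

section HeckeE

open scoped Manifold
open ZMod AddChar

variable {k N : ℕ} {χ : DirichletCharacter ℂ N} {p : ℕ} [Fact p.Prime]

/-- `q(w) = e^{2πiw}` for the period-`1` parameter. [folklore] -/
theorem qParam_one_eq (w : ℂ) : Function.Periodic.qParam 1 w = cexp (2 * π * I * w) := by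
  simp [Function.Periodic.qParam]

/-- `q(w)^n = e^{2πinw}`. [folklore] -/
theorem qParam_one_pow (w : ℂ) (n : ℕ) :
    Function.Periodic.qParam 1 w ^ n = cexp (2 * π * I * n * w) := by
  rw [qParam_one_eq, ← Complex.exp_nat_mul]
  ring_nf

omit [Fact p.Prime] in
/-- `e^{2πi m/M} = ψ_M(m)` for the standard additive character of `ℤ/M`. [folklore] -/
theorem cexp_natCast_div (M m : ℕ) [NeZero M] :
    cexp (2 * π * I * (m : ℂ) / (M : ℂ)) = stdAddChar ((m : ℕ) : ZMod M) := by
  have := stdAddChar_coe (N := M) (m : ℤ)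
  push_cast at this
  exact this.symm

/-- **The `U`-part**: if `f(τ) = Σ a(n) q(τ)ⁿ` on `ℍ` then
`Σ_{b mod p²} f((z + b)/p²) = Σ_m p² a(p² m) q(z)ᵐ`. [folklore] -/
theorem hasSum_sum_transDiv {f : ℍ → ℂ} {a : ℕ → ℂ}
    (hf : ∀ τ : ℍ, HasSum (fun n ↦ a n * Function.Periodic.qParam 1 τ ^ n) (f τ)) (z : ℍ) :
    HasSum (fun m : ℕ ↦ (p : ℂ) ^ 2 * a (p ^ 2 * m) * Function.Periodic.qParam 1 z ^ m)
      (∑ b : ZMod (p ^ 2), f (transDiv p b z)) := by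
  have hp := natCast_p_ne_zero (p := p)
  have hp2 : (p ^ 2 : ℕ) ≠ 0 := pow_ne_zero 2 (Fact.out : p.Prime).ne_zero
  haveI : NeZero (p ^ 2) := ⟨hp2⟩
  -- the finite sum of the `q`-series at the points `(z + b)/p²`
  have h1 : HasSum (fun n : ℕ ↦ ∑ b : ZMod (p ^ 2), a n * Function.Periodic.qParam 1
      (transDiv p b z) ^ n) (∑ b : ZMod (p ^ 2), f (transDiv p b z)) :=
    hasSum_sum fun b _ ↦ hf _
  -- evaluate the character sums
  have h2 : ∀ n : ℕ, (∑ b : ZMod (p ^ 2), a n * Function.Periodic.qParam 1 (transDiv p b z) ^ n) =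
      a n * cexp (2 * π * I * n * z / (p : ℂ) ^ 2) *
        (if (p ^ 2 : ℕ) ∣ n then ((p ^ 2 : ℕ) : ℂ) else 0) := by
    intro n
    have hq : ∀ b : ZMod (p ^ 2), Function.Periodic.qParam 1 (transDiv p b z) ^ n =
        cexp (2 * π * I * n * z / (p : ℂ) ^ 2) * stdAddChar ((n : ZMod (p ^ 2)) * b) := by
      intro b
      rw [qParam_one_pow, coe_transDiv, show ((n : ZMod (p ^ 2)) * b) =
          ((n * b.val : ℕ) : ZMod (p ^ 2)) by push_cast; rw [ZMod.natCast_zmod_val],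
        ← cexp_natCast_div (p ^ 2) (n * b.val), ← Complex.exp_add]
      congr 1
      push_cast
      field_simp
    simp_rw [hq]
    rw [← Finset.mul_sum, ← Finset.mul_sum, ← mul_assoc]
    congr 1
    have hs := AddChar.sum_mulShift (n : ZMod (p ^ 2)) (ZMod.isPrimitive_stdAddChar (p ^ 2))
    simp_rw [mul_comm _ (n : ZMod (p ^ 2))] at hs
    rw [hs, ZMod.card]
    by_cases hd : p ^ 2 ∣ n
    · rw [if_pos ((ZMod.natCast_eq_zero_iff n (p ^ 2)).mpr hd), if_pos hd]
    · rw [if_neg (fun h ↦ hd ((ZMod.natCast_eq_zero_iff n (p ^ 2)).mp h)), if_neg hd,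
        Nat.cast_zero]
  simp_rw [h2] at h1
  -- reindex `n = p² m`
  have hinj : Function.Injective (fun m : ℕ ↦ p ^ 2 * m) := mul_right_injective₀ hp2
  rw [← hinj.hasSum_iff (fun n hn ↦ by
    rw [Set.mem_range, not_exists] at hn
    rw [if_neg (fun ⟨m, hm⟩ ↦ hn m hm.symm), mul_zero])] at h1
  convert h1 using 1
  funext m
  simp only [Function.comp_apply]
  rw [if_pos (dvd_mul_right _ _), qParam_one_pow]
  push_cast
  field_simp

/-- **The linear twist**: `Σ_x (x/p) ψ_p(n x) = (n/p) G_p` (also for `n ≡ 0`, both sides `0`).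
[folklore] -/
theorem sum_quadCharC_mul_stdAddChar_linear (hp2 : p ≠ 2) (n : ZMod p) :
    ∑ x : ZMod p, quadCharC p x * stdAddChar (n * x) = quadCharC p n * legendreGaussSum p := by
  by_cases hn : n = 0
  · simp_rw [hn, zero_mul, map_zero_eq_one, mul_one, MulChar.map_zero, zero_mul]
    exact MulChar.sum_eq_zero_of_ne_one (quadCharC_ne_one hp2)
  · have h := gaussSum_mulShift_eq (quadCharC p) (stdAddChar (N := p)) (Units.mk0 n hn)
    have hχ : (quadCharC p)⁻¹ (Units.mk0 n hn : ZMod p) = quadCharC p n := by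
      rw [MulChar.inv_apply_eq_inv', Units.val_mk0]
      have h1 : quadCharC p n * quadCharC p n = 1 := by rw [← sq, quadCharC_sq_eq_one hn]
      exact inv_eq_of_mul_eq_one_right h1
    rw [hχ] at h
    unfold legendreGaussSum
    rw [← h]
    simp only [gaussSum, mulShift_apply, Units.val_mk0]

/-- `(t/p)` of the representative `t.val` is the quadratic character. [folklore] -/
theorem jacobiSym_val_eq_quadCharC (t : ZMod p) :
    ((J((t.val : ℤ) | p) : ℤ) : ℂ) = quadCharC p t := by
  rw [← jacobiSym.legendreSym.to_jacobiSym, legendreSym, quadCharC_apply, Int.cast_natCast,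
    ZMod.natCast_zmod_val]

/-- **The twisted part**: if `f(τ) = Σ a(n) q(τ)ⁿ` on `ℍ` then
`Σ_{t mod p} (t/p) f(z + t/p) = Σ_n (n/p) G_p a(n) q(z)ⁿ`. [folklore] -/
theorem hasSum_sum_jacobi_vadd (hp2 : p ≠ 2) {f : ℍ → ℂ} {a : ℕ → ℂ}
    (hf : ∀ τ : ℍ, HasSum (fun n ↦ a n * Function.Periodic.qParam 1 τ ^ n) (f τ)) (z : ℍ) :
    HasSum (fun n : ℕ ↦ quadCharC p n * legendreGaussSum p * a n * Function.Periodic.qParam 1 z ^ n)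
      (∑ t : ZMod p, (J((t.val : ℤ) | p) : ℂ) * f ((((t.val : ℕ) : ℝ) / (p : ℝ) : ℝ) +ᵥ z)) := by
  have hp := natCast_p_ne_zero (p := p)
  have h1 : HasSum (fun n : ℕ ↦ ∑ t : ZMod p, (J((t.val : ℤ) | p) : ℂ) *
      (a n * Function.Periodic.qParam 1 ((((t.val : ℕ) : ℝ) / (p : ℝ) : ℝ) +ᵥ z) ^ n))
      (∑ t : ZMod p, (J((t.val : ℤ) | p) : ℂ) * f ((((t.val : ℕ) : ℝ) / (p : ℝ) : ℝ) +ᵥ z)) :=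
    hasSum_sum fun t _ ↦ (hf _).mul_left _
  convert h1 using 1
  funext n
  have hq : ∀ t : ZMod p, Function.Periodic.qParam 1 ((((t.val : ℕ) : ℝ) / (p : ℝ) : ℝ) +ᵥ z) ^ n =
      Function.Periodic.qParam 1 z ^ n * stdAddChar ((n : ZMod p) * t) := by
    intro t
    rw [qParam_one_pow, qParam_one_pow, coe_vadd, show ((n : ZMod p) * t) =
        ((n * t.val : ℕ) : ZMod p) by push_cast; rw [ZMod.natCast_zmod_val],
      ← cexp_natCast_div p (n * t.val), ← Complex.exp_add]
    congr 1
    push_cast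
    field_simp
    ring
  simp_rw [hq, jacobiSym_val_eq_quadCharC]
  rw [← sum_quadCharC_mul_stdAddChar_linear hp2 n, Finset.sum_mul, Finset.sum_mul]
  refine Finset.sum_congr rfl fun t _ ↦ ?_
  ring

/-- **The `V`-part**: if `f(τ) = Σ a(n) q(τ)ⁿ` on `ℍ` then `f(p²z) = Σ_{p² ∣ m} a(m/p²) q(z)ᵐ`.
[folklore] -/
theorem hasSum_mulPSq {f : ℍ → ℂ} {a : ℕ → ℂ}
    (hf : ∀ τ : ℍ, HasSum (fun n ↦ a n * Function.Periodic.qParam 1 τ ^ n) (f τ)) (z : ℍ) :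
    HasSum (fun m : ℕ ↦ (if p ^ 2 ∣ m then a (m / p ^ 2) else 0) * Function.Periodic.qParam 1 z ^ m)
      (f (mulPSq p z)) := by
  have hp2 : (p ^ 2 : ℕ) ≠ 0 := pow_ne_zero 2 (Fact.out : p.Prime).ne_zero
  have h1 := hf (mulPSq p z)
  have hinj : Function.Injective (fun m : ℕ ↦ p ^ 2 * m) := mul_right_injective₀ hp2
  rw [← hinj.hasSum_iff (fun n hn ↦ by
    rw [Set.mem_range, not_exists] at hn
    rw [if_neg (fun ⟨m, hm⟩ ↦ hn m hm.symm), zero_mul])]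
  convert h1 using 1
  funext n
  simp only [Function.comp_apply]
  rw [if_pos (dvd_mul_right _ _), Nat.mul_div_cancel_left _ (Nat.pos_of_ne_zero hp2),
    qParam_one_pow, qParam_one_pow, coe_mulPSq]
  congr 1
  push_cast
  ring_nf

/-- `(k - 1)/2 = λ` for `k = 2λ + 1`. [folklore] -/
theorem half_of_odd {l : ℕ} : (2 * l + 1 - 1) / 2 = l := by omega

/-- **The constant of the middle term**: for `p` odd and `k = 2λ + 1`,
`p⁻² (ε_p⁻¹ √p)^k G_p = (-1/p)^λ p^{λ - 1}` (with `G_p = ε_p √p`, `ε_p⁻² = (-1/p)`). [folklore] -/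
theorem middle_const (hp2 : p ≠ 2) (hk : Odd k) :
    ((p : ℂ) ^ 2)⁻¹ * ((thetaEps p)⁻¹ * (Real.sqrt p : ℂ)) ^ k * legendreGaussSum p =
      (J(-1 | p) : ℂ) ^ ((k - 1) / 2) * (p : ℂ) ^ ((((k - 1) / 2 : ℕ) : ℤ) - 1) := by
  have hpp : p.Prime := Fact.out
  have hp := natCast_p_ne_zero (p := p)
  have hpodd : Odd p := Nat.odd_iff.mpr (hpp.eq_two_or_odd.resolve_left hp2)
  obtain ⟨l, rfl⟩ := hk
  rw [half_of_odd, legendreGaussSum_eq hp2, jacobiSym.at_neg_one hpodd]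
  -- `ε⁻¹^(2l+1) ε = (ε⁻²)^l`, `√p^(2l+1) √p = p^(l+1)`
  have hε0 := thetaEps_ne_zero (p : ℤ)
  have hεsq := thetaEps_inv_sq (p : ℤ)
  have hsq : ((Real.sqrt p : ℂ)) ^ 2 = p := by
    rw [← Complex.ofReal_pow, Real.sq_sqrt (Nat.cast_nonneg p), Complex.ofReal_natCast]
  have hχ₄ : (ZMod.χ₄ (p : ZMod 4) : ℂ) = (thetaEps (p : ℤ))⁻¹ ^ 2 := by
    rw [hεsq, ZMod.χ₄_nat_eq_if_mod_four]
    have hodd : p % 2 = 1 := hpp.eq_two_or_odd.resolve_left hp2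
    have h4 : p % 4 = 1 ∨ p % 4 = 3 := by omega
    rcases h4 with h4 | h4
    · rw [if_neg (by omega), if_pos h4, if_neg (by omega)]; simp
    · rw [if_neg (by omega), if_neg (by omega), if_pos (by omega)]; simp
  rw [hχ₄, zpow_sub₀ hp, zpow_natCast, zpow_one]
  have key : ((thetaEps (p : ℤ))⁻¹ * (Real.sqrt p : ℂ)) ^ (2 * l + 1) *
      (thetaEps (p : ℤ) * (Real.sqrt p : ℂ)) =
      ((thetaEps (p : ℤ))⁻¹ ^ 2) ^ l * (p : ℂ) ^ (l + 1) := by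
    rw [show ((thetaEps (p : ℤ))⁻¹ * (Real.sqrt p : ℂ)) ^ (2 * l + 1) *
        (thetaEps (p : ℤ) * (Real.sqrt p : ℂ))
        = ((thetaEps (p : ℤ))⁻¹ ^ 2) ^ l * ((Real.sqrt p : ℂ) ^ 2) ^ (l + 1) *
          ((thetaEps (p : ℤ))⁻¹ * thetaEps (p : ℤ)) by ring, hsq, inv_mul_cancel₀ hε0, mul_one]
  rw [mul_assoc, key]
  field_simp
  ring

/-- The symbol of the middle term: `((-1)^λ n / p) = (-1/p)^λ (n/p)`. [folklore] -/
theorem jacobiSym_middle (n l : ℕ) :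
    ((J(((-1) ^ l * (n : ℤ) : ℤ) | p) : ℤ) : ℂ) = (J(-1 | p) : ℂ) ^ l * quadCharC p n := by
  rw [jacobiSym.mul_left, jacobiSym.pow_left, Int.cast_mul, Int.cast_pow]
  congr 1
  rw [← jacobiSym.legendreSym.to_jacobiSym p (n : ℤ), legendreSym, quadCharC_apply,
    Int.cast_natCast]

/-- **The `q`-expansion of `T(p²) f` is Shimura's formula**: for `f ∈ M_{k/2}(N, χ)` (`k` odd,
`4 ∣ N`), `(T(p²) f)(z) = Σ_n b(n) q(z)ⁿ` with `b = heckeTSq k χ p (qCoeffs f)`, i.e.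
`b(n) = a(p²n) + χ(p) ((-1)^λ n/p) p^{λ-1} a(n) + χ(p²) p^{k-2} a(n/p²)`.
[cite: Shimura1973HalfIntegral, Thm. 1.7] -/
theorem hasSum_heckeFun (hN : 4 ∣ N) (hk : Odd k) {f : ℍ → ℂ} (hf : f ∈ halfIntModularForms k N χ)
    (z : ℍ) : HasSum (fun n ↦ heckeTSq k χ p (qCoeffs f) n * Function.Periodic.qParam 1 z ^ n)
      (heckeFun k χ p f z) := by
  have hp := natCast_p_ne_zero (p := p)
  have hfs : ∀ τ : ℍ, HasSum (fun n ↦ qCoeffs f n * Function.Periodic.qParam 1 τ ^ n) (f τ) :=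
    fun τ ↦ hasSum_qCoeffs hf τ
  have hU := hasSum_sum_transDiv (p := p) hfs z
  have hV := hasSum_mulPSq (p := p) hfs z
  have hz2 : ((p : ℂ) ^ 2)⁻¹ * (p : ℂ) ^ k = (p : ℂ) ^ ((k : ℤ) - 2) := by
    rw [zpow_sub₀ hp, zpow_natCast, zpow_ofNat]; ring
  by_cases hχ : χ (p : ZMod N) = 0
  · -- `χ(p) = 0`: only the `U`-part
    have hχ2 : χ ((p : ZMod N) ^ 2) = 0 := by rw [map_pow, hχ]; ring
    have h := hU.mul_left (((p : ℂ) ^ 2)⁻¹)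
    have heq : heckeFun k χ p f z = ((p : ℂ) ^ 2)⁻¹ * ∑ b : ZMod (p ^ 2), f (transDiv p b z) := by
      rw [heckeFun, hχ, hχ2]; ring
    rw [heq]
    refine h.congr_fun fun n ↦ ?_
    rw [heckeTSq_apply, hχ, hχ2]
    field_simp
    ring
  · -- `χ(p) ≠ 0`: then `p ∤ N`, `p` is odd, and the Gauss sum enters
    have hpN : ¬ p ∣ N := fun h ↦ hχ (chi_p_eq_zero h)
    have hp2 : p ≠ 2 := fun h2 ↦ hpN (h2 ▸ dvd_trans ⟨2, rfl⟩ hN)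
    have hW := hasSum_sum_jacobi_vadd (p := p) hp2 hfs z
    have h := ((hU.add (hW.mul_left (χ (p : ZMod N) *
      ((thetaEps p)⁻¹ * (Real.sqrt p : ℂ)) ^ k))).add
      (hV.mul_left (χ ((p : ZMod N) ^ 2) * (p : ℂ) ^ k))).mul_left (((p : ℂ) ^ 2)⁻¹)
    have heq : heckeFun k χ p f z = ((p : ℂ) ^ 2)⁻¹ * (∑ b : ZMod (p ^ 2), f (transDiv p b z) +
        χ (p : ZMod N) * ((thetaEps p)⁻¹ * (Real.sqrt p : ℂ)) ^ k *
          ∑ t : ZMod p, (J((t.val : ℤ) | p) : ℂ) * f ((((t.val : ℕ) : ℝ) / (p : ℝ) : ℝ) +ᵥ z) +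
        χ ((p : ZMod N) ^ 2) * (p : ℂ) ^ k * f (mulPSq p z)) := rfl
    rw [heq]
    refine h.congr_fun fun n ↦ ?_
    have hm := middle_const (p := p) hp2 hk
    have hp2' : ((p : ℂ) ^ 2)⁻¹ * (p : ℂ) ^ 2 = 1 := inv_mul_cancel₀ (pow_ne_zero 2 hp)
    rw [heckeTSq_apply, jacobiSym_middle, ← hz2]
    linear_combination (-(χ (p : ZMod N) * quadCharC p n * qCoeffs f n *
      Function.Periodic.qParam 1 z ^ n)) * hm +
      (-(qCoeffs f (p ^ 2 * n) * Function.Periodic.qParam 1 z ^ n)) * hp2'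

/-- **`qCoeffs (T(p²) f) = heckeTSq k χ p (qCoeffs f)`** for `f ∈ M_{k/2}(N, χ)`.
[cite: Shimura1973HalfIntegral, Thm. 1.7] -/
theorem qCoeffs_heckeFun (hN : 4 ∣ N) (hk : Odd k) {f : ℍ → ℂ}
    (hf : f ∈ halfIntModularForms k N χ) :
    qCoeffs (heckeFun k χ p f) = heckeTSq k χ p (qCoeffs f) :=
  qCoeffs_eq_of_hasSum (hasSum_heckeFun hN hk hf)

/-- `T(p²) f` is holomorphic (it is a convergent `q`-series). [folklore] -/
theorem mdifferentiable_heckeFun (hN : 4 ∣ N) (hk : Odd k) {f : ℍ → ℂ}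
    (hf : f ∈ halfIntModularForms k N χ) : MDiff (heckeFun k χ p f) :=
  mdifferentiable_of_hasSum (hasSum_heckeFun hN hk hf)

end HeckeE

/-! ## Part 8. Behaviour at the cusps: `f ↦ f((Az + B)/D)` preserves the cusp conditions -/

section HeckeF

open scoped Manifold

variable {k N : ℕ} {χ : DirichletCharacter ℂ N} {p : ℕ} [Fact p.Prime]

omit [Fact p.Prime] in
/-- **Hermite normal form** of an integer matrix of positive determinant: `M = σ' (A' B'; 0 D')`
with `σ' ∈ SL₂(ℤ)` and `A', D' > 0` (Bezout on the first column). [folklore] -/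
theorem exists_SL2_mul_upper (m₀₀ m₀₁ m₁₀ m₁₁ : ℤ) (hdet : 0 < m₀₀ * m₁₁ - m₀₁ * m₁₀) :
    ∃ (σ' : SL(2, ℤ)) (A' B' D' : ℤ), 0 < A' ∧ 0 < D' ∧
      m₀₀ = σ' 0 0 * A' ∧ m₀₁ = σ' 0 0 * B' + σ' 0 1 * D' ∧
      m₁₀ = σ' 1 0 * A' ∧ m₁₁ = σ' 1 0 * B' + σ' 1 1 * D' := by
  have hg0 : 0 < (Int.gcd m₀₀ m₁₀ : ℤ) := by
    apply Int.natCast_pos.mpr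
    apply Nat.pos_of_ne_zero
    intro h0
    rw [Int.gcd_eq_zero_iff] at h0
    rw [h0.1, h0.2] at hdet
    simp at hdet
  obtain ⟨a', ha'⟩ : (Int.gcd m₀₀ m₁₀ : ℤ) ∣ m₀₀ := Int.gcd_dvd_left _ _
  obtain ⟨c', hc'⟩ : (Int.gcd m₀₀ m₁₀ : ℤ) ∣ m₁₀ := Int.gcd_dvd_right _ _
  -- Bezout: `g = m₀₀ x + m₁₀ y`, so `a' x + c' y = 1`
  have hbez : (Int.gcd m₀₀ m₁₀ : ℤ) = m₀₀ * Int.gcdA m₀₀ m₁₀ + m₁₀ * Int.gcdB m₀₀ m₁₀ :=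
    Int.gcd_eq_gcd_ab m₀₀ m₁₀
  set g : ℤ := (Int.gcd m₀₀ m₁₀ : ℤ) with hg
  set x := Int.gcdA m₀₀ m₁₀
  set y := Int.gcdB m₀₀ m₁₀
  have h1 : a' * x + c' * y = 1 := by
    apply mul_left_cancel₀ hg0.ne'
    linear_combination -hbez - x * ha' - y * hc'
  refine ⟨⟨!![a', -y; c', x], by rw [Matrix.det_fin_two_of]; linear_combination h1⟩,
    g, x * m₀₁ + y * m₁₁, -c' * m₀₁ + a' * m₁₁, hg0, ?_, ?_, ?_, ?_, ?_⟩
  · -- `g D' = det M > 0`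
    have : g * (-c' * m₀₁ + a' * m₁₁) = m₀₀ * m₁₁ - m₀₁ * m₁₀ := by
      rw [ha', hc']; ring
    nlinarith
  · show m₀₀ = a' * g
    rw [ha']; ring
  · show m₀₁ = a' * (x * m₀₁ + y * m₁₁) + -y * (-c' * m₀₁ + a' * m₁₁)
    linear_combination -m₀₁ * h1
  · show m₁₀ = c' * g
    rw [hc']; ring
  · show m₁₁ = c' * (x * m₀₁ + y * m₁₁) + x * (-c' * m₀₁ + a' * m₁₁)
    linear_combination -m₁₁ * h1

omit [Fact p.Prime] in
/-- The point `(Az + B)/D ∈ ℍ` for `A, D > 0`: imaginary part `(A/D) Im z`. [folklore] -/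
theorem im_affine {A B D : ℤ} (hD : 0 < D) (z : ℍ) :
    (((A : ℂ) * z + B) / D).im = (A : ℝ) / D * z.im := by
  have hD0 : (D : ℂ) ≠ 0 := by exact_mod_cast hD.ne'
  rw [show ((A : ℂ) * z + B) / D = ((A / D : ℝ) : ℂ) * (z : ℂ) + ((B / D : ℝ) : ℂ) by
    push_cast; field_simp, Complex.add_im, Complex.im_ofReal_mul, Complex.ofReal_im, add_zero]
  rfl

omit [Fact p.Prime] in
/-- The point `(Az + B)/D ∈ ℍ`. [folklore] -/
def affinePt {A D : ℤ} (B : ℤ) (hA : 0 < A) (hD : 0 < D) (z : ℍ) : ℍ :=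
  ⟨((A : ℂ) * z + B) / D, by
    rw [im_affine hD]
    exact mul_pos (div_pos (Int.cast_pos.mpr hA) (Int.cast_pos.mpr hD)) z.2⟩

omit [Fact p.Prime] in
/-- `affinePt B hA hD z = (Az + B)/D`. [folklore] -/
theorem coe_affinePt {A D : ℤ} (B : ℤ) (hA : 0 < A) (hD : 0 < D) (z : ℍ) :
    ((affinePt B hA hD z : ℍ) : ℂ) = ((A : ℂ) * z + B) / D := rfl

omit [Fact p.Prime] in
/-- **The geometry behind the cusp transport.** For `A, D > 0`, `B ∈ ℤ` and `σ ∈ SL₂(ℤ)`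
there are `σ' ∈ SL₂(ℤ)` and `A', D' > 0`, `B'` with, for all `z` and `w = (A'z + B')/D'`:
`(A σz + B)/D = σ' w` and `D (c_σ z + d_σ) = D' (c_{σ'} w + d_{σ'})`
(Hermite form of `(A B; 0 D) σ = σ' (A' B'; 0 D')`). [folklore] -/
theorem exists_affine_conj {A B D : ℤ} (hA : 0 < A) (hD : 0 < D) (σ : SL(2, ℤ)) :
    ∃ (σ' : SL(2, ℤ)) (A' B' D' : ℤ) (hA' : 0 < A') (hD' : 0 < D'), ∀ z : ℍ,
      ((A : ℂ) * ((σ • z : ℍ) : ℂ) + B) / D = ((σ' • affinePt B' hA' hD' z : ℍ) : ℂ) ∧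
      (D : ℂ) * (((σ 1 0 : ℤ) : ℂ) * z + ((σ 1 1 : ℤ) : ℂ)) =
        D' * (((σ' 1 0 : ℤ) : ℂ) * ((affinePt B' hA' hD' z : ℍ) : ℂ) + ((σ' 1 1 : ℤ) : ℂ)) := by
  have hdetσ := det_entries σ
  obtain ⟨σ', A', B', D', hA', hD', h00, h01, h10, h11⟩ := exists_SL2_mul_upper
    (A * σ 0 0 + B * σ 1 0) (A * σ 0 1 + B * σ 1 1) (D * σ 1 0) (D * σ 1 1)
    (by nlinarith [mul_pos hA hD])
  refine ⟨σ', A', B', D', hA', hD', fun z ↦ ?_⟩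
  have hD0 : (D : ℂ) ≠ 0 := by exact_mod_cast hD.ne'
  have hD'0 : (D' : ℂ) ≠ 0 := by exact_mod_cast hD'.ne'
  have hdenz : ((σ 1 0 : ℤ) : ℂ) * z + ((σ 1 1 : ℤ) : ℂ) ≠ 0 :=
    intLinear_ne_zero (gcd_c_d_eq_one σ) z
  have e00 : (A : ℂ) * ((σ 0 0 : ℤ) : ℂ) + B * ((σ 1 0 : ℤ) : ℂ) = ((σ' 0 0 : ℤ) : ℂ) * A' := by
    exact_mod_cast h00
  have e01 : (A : ℂ) * ((σ 0 1 : ℤ) : ℂ) + B * ((σ 1 1 : ℤ) : ℂ) =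
      ((σ' 0 0 : ℤ) : ℂ) * B' + ((σ' 0 1 : ℤ) : ℂ) * D' := by exact_mod_cast h01
  have e10 : (D : ℂ) * ((σ 1 0 : ℤ) : ℂ) = ((σ' 1 0 : ℤ) : ℂ) * A' := by exact_mod_cast h10
  have e11 : (D : ℂ) * ((σ 1 1 : ℤ) : ℂ) = ((σ' 1 0 : ℤ) : ℂ) * B' + ((σ' 1 1 : ℤ) : ℂ) * D' := by
    exact_mod_cast h11
  rw [coe_affinePt]
  constructor
  · rw [coe_specialLinearGroup_apply, coe_specialLinearGroup_apply, coe_affinePt]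
    simp only [eq_intCast]
    push_cast
    -- left-hand side in Hermite coordinates
    rw [mul_div_assoc', div_add' _ _ _ hdenz, div_div,
      show (A : ℂ) * (((σ 0 0 : ℤ) : ℂ) * z + ((σ 0 1 : ℤ) : ℂ)) + B * (((σ 1 0 : ℤ) : ℂ) * z +
        ((σ 1 1 : ℤ) : ℂ)) = (((σ' 0 0 : ℤ) : ℂ) * A') * z + (((σ' 0 0 : ℤ) : ℂ) * B' +
          ((σ' 0 1 : ℤ) : ℂ) * D') by linear_combination z * e00 + e01,
      show (((σ 1 0 : ℤ) : ℂ) * z + ((σ 1 1 : ℤ) : ℂ)) * D = (((σ' 1 0 : ℤ) : ℂ) * A') * z +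
        (((σ' 1 0 : ℤ) : ℂ) * B' + ((σ' 1 1 : ℤ) : ℂ) * D') by linear_combination z * e10 + e11]
    -- right-hand side
    rw [mul_div_assoc', mul_div_assoc', div_add' _ _ _ hD'0, div_add' _ _ _ hD'0,
      div_div_div_cancel_right₀ hD'0]
    ring
  · field_simp
    linear_combination z * e10 + e11

omit [Fact p.Prime] in
/-- **The value of `slashSq` along `φ(z) = (Az + B)/D`**: with `σ', w` as in
`exists_affine_conj`, `slashSq k (f ∘ φ) σ z = (D/D')^k · slashSq k f σ' w`. [folklore] -/
theorem slashSq_comp_eq {f : ℍ → ℂ} {φ : ℍ → ℍ} {A B D : ℤ} (hD : 0 < D)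
    (hφ : ∀ z : ℍ, ((φ z : ℍ) : ℂ) = ((A : ℂ) * z + B) / D) {σ σ' : SL(2, ℤ)} {A' B' D' : ℤ}
    (hA' : 0 < A') (hD' : 0 < D') (z : ℍ)
    (h1 : ((A : ℂ) * ((σ • z : ℍ) : ℂ) + B) / D = ((σ' • affinePt B' hA' hD' z : ℍ) : ℂ))
    (h2 : (D : ℂ) * (((σ 1 0 : ℤ) : ℂ) * z + ((σ 1 1 : ℤ) : ℂ)) =
      D' * (((σ' 1 0 : ℤ) : ℂ) * ((affinePt B' hA' hD' z : ℍ) : ℂ) + ((σ' 1 1 : ℤ) : ℂ))) :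
    slashSq k (f ∘ φ) σ z = ((D : ℂ) / D') ^ k * slashSq k f σ' (affinePt B' hA' hD' z) := by
  have hD0 : (D : ℂ) ≠ 0 := by exact_mod_cast hD.ne'
  have hD'0 : (D' : ℂ) ≠ 0 := by exact_mod_cast hD'.ne'
  have hpt : φ (σ • z) = σ' • affinePt B' hA' hD' z := UpperHalfPlane.ext (by rw [hφ, h1])
  simp only [slashSq, Function.comp_apply, hpt, ModularGroup.denom_apply]
  have hdenw : ((σ' 1 0 : ℤ) : ℂ) * ((affinePt B' hA' hD' z : ℍ) : ℂ) + ((σ' 1 1 : ℤ) : ℂ) ≠ 0 :=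
    intLinear_ne_zero (gcd_c_d_eq_one σ') _
  rw [show ((σ 1 0 : ℤ) : ℂ) * z + ((σ 1 1 : ℤ) : ℂ) = (D' : ℂ) / D *
      (((σ' 1 0 : ℤ) : ℂ) * ((affinePt B' hA' hD' z : ℍ) : ℂ) + ((σ' 1 1 : ℤ) : ℂ)) by
    field_simp; linear_combination h2]
  rw [mul_pow, div_pow, div_pow]
  field_simp

omit [Fact p.Prime] in
/-- **Transport of the cusp conditions along `z ↦ (Az + B)/D`**: if `slashSq k f σ'` is
bounded at `i∞` for every `σ' ∈ SL₂(ℤ)`, then so is `slashSq k (f ∘ φ) σ` for every `σ`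
(`Im w = (A'/D') Im z → ∞`). [folklore] -/
theorem isBoundedAtImInfty_slashSq_comp {f : ℍ → ℂ} {φ : ℍ → ℍ} {A B D : ℤ} (hA : 0 < A)
    (hD : 0 < D) (hφ : ∀ z : ℍ, ((φ z : ℍ) : ℂ) = ((A : ℂ) * z + B) / D)
    (hf : ∀ σ' : SL(2, ℤ), IsBoundedAtImInfty (slashSq k f σ')) (σ : SL(2, ℤ)) :
    IsBoundedAtImInfty (slashSq k (f ∘ φ) σ) := by
  obtain ⟨σ', A', B', D', hA', hD', hconj⟩ := exists_affine_conj (B := B) hA hD σ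
  obtain ⟨M, A₀, hM⟩ := isBoundedAtImInfty_iff.mp (hf σ')
  rw [isBoundedAtImInfty_iff]
  have hA'r : (0 : ℝ) < A' := Int.cast_pos.mpr hA'
  have hD'r : (0 : ℝ) < D' := Int.cast_pos.mpr hD'
  refine ⟨((D : ℝ) / D') ^ k * M, A₀ * D' / A', fun z hz ↦ ?_⟩
  have hwim : A₀ ≤ (affinePt B' hA' hD' z).im := by
    show A₀ ≤ (((A' : ℂ) * z + B') / D').im
    rw [im_affine hD', div_mul_eq_mul_div, le_div_iff₀ hD'r]
    calc A₀ * D' = A₀ * D' / A' * A' := by field_simp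
      _ ≤ z.im * A' := by gcongr
      _ = A' * z.im := mul_comm _ _
  rw [slashSq_comp_eq hD hφ hA' hD' z (hconj z).1 (hconj z).2, norm_mul, norm_pow, norm_div,
    Complex.norm_intCast, Complex.norm_intCast, abs_of_pos (Int.cast_pos.mpr hD),
    abs_of_pos (Int.cast_pos.mpr hD')]
  exact mul_le_mul_of_nonneg_left (hM _ hwim) (by positivity)

omit [Fact p.Prime] in
/-- **Transport of the cusp-form conditions along `z ↦ (Az + B)/D`** (the `IsZeroAtImInfty`
version). [folklore] -/
theorem isZeroAtImInfty_slashSq_comp {f : ℍ → ℂ} {φ : ℍ → ℍ} {A B D : ℤ} (hA : 0 < A)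
    (hD : 0 < D) (hφ : ∀ z : ℍ, ((φ z : ℍ) : ℂ) = ((A : ℂ) * z + B) / D)
    (hf : ∀ σ' : SL(2, ℤ), IsZeroAtImInfty (slashSq k f σ')) (σ : SL(2, ℤ)) :
    IsZeroAtImInfty (slashSq k (f ∘ φ) σ) := by
  obtain ⟨σ', A', B', D', hA', hD', hconj⟩ := exists_affine_conj (B := B) hA hD σ
  have hA'r : (0 : ℝ) < A' := Int.cast_pos.mpr hA'
  have hD'r : (0 : ℝ) < D' := Int.cast_pos.mpr hD'
  have hc : 0 < ((D : ℝ) / D') ^ k := by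
    have : (0 : ℝ) < D := Int.cast_pos.mpr hD
    positivity
  rw [isZeroAtImInfty_iff]
  intro ε hε
  obtain ⟨A₀, hA₀⟩ := (isZeroAtImInfty_iff.mp (hf σ')) (ε / ((D : ℝ) / D') ^ k) (div_pos hε hc)
  refine ⟨A₀ * D' / A', fun z hz ↦ ?_⟩
  have hwim : A₀ ≤ (affinePt B' hA' hD' z).im := by
    show A₀ ≤ (((A' : ℂ) * z + B') / D').im
    rw [im_affine hD', div_mul_eq_mul_div, le_div_iff₀ hD'r]
    calc A₀ * D' = A₀ * D' / A' * A' := by field_simp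
      _ ≤ z.im * A' := by gcongr
      _ = A' * z.im := mul_comm _ _
  rw [slashSq_comp_eq hD hφ hA' hD' z (hconj z).1 (hconj z).2, norm_mul, norm_pow, norm_div,
    Complex.norm_intCast, Complex.norm_intCast, abs_of_pos (Int.cast_pos.mpr hD),
    abs_of_pos (Int.cast_pos.mpr hD')]
  calc ((D : ℝ) / D') ^ k * ‖slashSq k f σ' (affinePt B' hA' hD' z)‖
      ≤ ((D : ℝ) / D') ^ k * (ε / ((D : ℝ) / D') ^ k) :=
        mul_le_mul_of_nonneg_left (hA₀ _ hwim) hc.le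
    _ = ε := by field_simp

/-! ### Finite sums and scalar multiples -/

omit [Fact p.Prime] in
/-- `slashSq` of a finite sum is bounded at `i∞` if every summand's is. [folklore] -/
theorem isBoundedAtImInfty_slashSq_sum {ι : Type*} (s : Finset ι) (F : ι → ℍ → ℂ) (σ : SL(2, ℤ))
    (h : ∀ i ∈ s, IsBoundedAtImInfty (slashSq k (F i) σ)) :
    IsBoundedAtImInfty (slashSq k (∑ i ∈ s, F i) σ) := by
  classical
  induction s using Finset.induction_on with
  | empty =>
    rw [Finset.sum_empty, slashSq_zero]
    exact UpperHalfPlane.zero_form_isBoundedAtImInfty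
  | insert a s ha ih =>
    rw [Finset.sum_insert ha]
    exact isBoundedAtImInfty_slashSq_add (h a (Finset.mem_insert_self a s))
      (ih fun i hi ↦ h i (Finset.mem_insert_of_mem hi))

omit [Fact p.Prime] in
/-- `slashSq` of a finite sum tends to `0` at `i∞` if every summand's does. [folklore] -/
theorem isZeroAtImInfty_slashSq_sum {ι : Type*} (s : Finset ι) (F : ι → ℍ → ℂ) (σ : SL(2, ℤ))
    (h : ∀ i ∈ s, IsZeroAtImInfty (slashSq k (F i) σ)) :
    IsZeroAtImInfty (slashSq k (∑ i ∈ s, F i) σ) := by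
  classical
  induction s using Finset.induction_on with
  | empty =>
    rw [Finset.sum_empty, slashSq_zero]
    exact Filter.zero_zeroAtFilter _
  | insert a s ha ih =>
    rw [Finset.sum_insert ha]
    exact isZeroAtImInfty_slashSq_add (h a (Finset.mem_insert_self a s))
      (ih fun i hi ↦ h i (Finset.mem_insert_of_mem hi))

omit [Fact p.Prime] in
/-- `slashSq (c • F)` is bounded at `i∞` if `slashSq F` is. [folklore] -/
theorem isBoundedAtImInfty_slashSq_smul {F : ℍ → ℂ} (c : ℂ) {σ : SL(2, ℤ)}
    (h : IsBoundedAtImInfty (slashSq k F σ)) : IsBoundedAtImInfty (slashSq k (c • F) σ) := by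
  rw [slashSq_smul]; exact h.const_smul_left (c ^ 2)

omit [Fact p.Prime] in
/-- `slashSq (c • F)` tends to `0` at `i∞` if `slashSq F` does. [folklore] -/
theorem isZeroAtImInfty_slashSq_smul {F : ℍ → ℂ} (c : ℂ) {σ : SL(2, ℤ)}
    (h : IsZeroAtImInfty (slashSq k F σ)) : IsZeroAtImInfty (slashSq k (c • F) σ) := by
  rw [slashSq_smul]; exact h.smul (c ^ 2)

/-! ### `T(p²) f` at the cusps -/

/-- `T(p²) f` as a combination of the functions `f ∘ φ`. [folklore] -/
theorem heckeFun_eq_sum (f : ℍ → ℂ) :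
    heckeFun k χ p f = ((p : ℂ) ^ 2)⁻¹ • ((∑ b : ZMod (p ^ 2), (f ∘ transDiv p b)) +
      (χ (p : ZMod N) * ((thetaEps p)⁻¹ * (Real.sqrt p : ℂ)) ^ k) •
        (∑ t : ZMod p, ((J((t.val : ℤ) | p) : ℂ) • (f ∘ fun z : ℍ ↦
          ((((t.val : ℕ) : ℝ) / (p : ℝ) : ℝ) +ᵥ z)))) +
      (χ ((p : ZMod N) ^ 2) * (p : ℂ) ^ k) • (f ∘ mulPSq p)) := by
  funext z
  simp only [heckeFun, Pi.smul_apply, Pi.add_apply, Finset.sum_apply, Function.comp_apply,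
    smul_eq_mul]

/-- The three maps `z ↦ (z + b)/p²`, `z ↦ z + t/p`, `z ↦ p² z` are of the form `(Az + B)/D`.
[folklore] -/
theorem coe_transDiv_affine (b : ZMod (p ^ 2)) (z : ℍ) :
    ((transDiv p b z : ℍ) : ℂ) =
      (((1 : ℤ) : ℂ) * z + ((b.val : ℤ) : ℂ)) / (((p : ℤ) ^ 2 : ℤ) : ℂ) := by
  rw [coe_transDiv]; push_cast; ring

/-- See `coe_transDiv_affine`. [folklore] -/
theorem coe_vadd_affine (t : ZMod p) (z : ℍ) :
    (((((((t.val : ℕ) : ℝ) / (p : ℝ) : ℝ) +ᵥ z)) : ℍ) : ℂ) =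
      (((p : ℤ) : ℂ) * z + ((t.val : ℤ) : ℂ)) / ((p : ℤ) : ℂ) := by
  rw [coe_vadd]; push_cast; field_simp [natCast_p_ne_zero (p := p)]; ring

/-- See `coe_transDiv_affine`. [folklore] -/
theorem coe_mulPSq_affine (z : ℍ) :
    ((mulPSq p z : ℍ) : ℂ) = ((((p : ℤ) ^ 2 : ℤ)) * z + ((0 : ℤ) : ℂ)) / ((1 : ℤ) : ℂ) := by
  rw [coe_mulPSq]; push_cast; ring

/-- **`T(p²) f` is bounded at every cusp** when `f` is. [cite: Shimura1973HalfIntegral, Thm. 1.7] -/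
theorem isBoundedAtImInfty_slashSq_heckeFun {f : ℍ → ℂ}
    (hf : ∀ σ : SL(2, ℤ), IsBoundedAtImInfty (slashSq k f σ)) (σ : SL(2, ℤ)) :
    IsBoundedAtImInfty (slashSq k (heckeFun k χ p f) σ) := by
  have hp : (0 : ℤ) < p := by exact_mod_cast (Fact.out : p.Prime).pos
  have hp2 : (0 : ℤ) < (p : ℤ) ^ 2 := by positivity
  rw [heckeFun_eq_sum]
  refine isBoundedAtImInfty_slashSq_smul _ (isBoundedAtImInfty_slashSq_add
    (isBoundedAtImInfty_slashSq_add ?_ (isBoundedAtImInfty_slashSq_smul _ ?_))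
    (isBoundedAtImInfty_slashSq_smul _ ?_))
  · exact isBoundedAtImInfty_slashSq_sum _ _ σ fun b _ ↦
      isBoundedAtImInfty_slashSq_comp one_pos hp2 (coe_transDiv_affine b) hf σ
  · exact isBoundedAtImInfty_slashSq_sum _ _ σ fun t _ ↦ isBoundedAtImInfty_slashSq_smul _
      (isBoundedAtImInfty_slashSq_comp hp hp (coe_vadd_affine t) hf σ)
  · exact isBoundedAtImInfty_slashSq_comp hp2 one_pos coe_mulPSq_affine hf σ

/-- **`T(p²) f` vanishes at every cusp** when `f` does. [cite: Shimura1973HalfIntegral, Thm. 1.7] -/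
theorem isZeroAtImInfty_slashSq_heckeFun {f : ℍ → ℂ}
    (hf : ∀ σ : SL(2, ℤ), IsZeroAtImInfty (slashSq k f σ)) (σ : SL(2, ℤ)) :
    IsZeroAtImInfty (slashSq k (heckeFun k χ p f) σ) := by
  have hp : (0 : ℤ) < p := by exact_mod_cast (Fact.out : p.Prime).pos
  have hp2 : (0 : ℤ) < (p : ℤ) ^ 2 := by positivity
  rw [heckeFun_eq_sum]
  refine isZeroAtImInfty_slashSq_smul _ (isZeroAtImInfty_slashSq_add
    (isZeroAtImInfty_slashSq_add ?_ (isZeroAtImInfty_slashSq_smul _ ?_))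
    (isZeroAtImInfty_slashSq_smul _ ?_))
  · exact isZeroAtImInfty_slashSq_sum _ _ σ fun b _ ↦
      isZeroAtImInfty_slashSq_comp one_pos hp2 (coe_transDiv_affine b) hf σ
  · exact isZeroAtImInfty_slashSq_sum _ _ σ fun t _ ↦ isZeroAtImInfty_slashSq_smul _
      (isZeroAtImInfty_slashSq_comp hp hp (coe_vadd_affine t) hf σ)
  · exact isZeroAtImInfty_slashSq_comp hp2 one_pos coe_mulPSq_affine hf σ

end HeckeF

/-! ## Part 9. Assembly: Shimura 1973, Theorem 1.7 -/

section HeckeG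

open scoped Manifold

variable {k N : ℕ} {χ : DirichletCharacter ℂ N} {p : ℕ} [Fact p.Prime]

/-- **`T(p²)` maps `M_{k/2}(N, χ)` to itself** (`k` odd, `4 ∣ N`, `p` prime).
[cite: Shimura1973HalfIntegral, Thm. 1.7] -/
theorem heckeFun_mem (hN : 4 ∣ N) (hk : Odd k) {f : ℍ → ℂ} (hf : f ∈ halfIntModularForms k N χ) :
    heckeFun k χ p f ∈ halfIntModularForms k N χ :=
  ⟨mdifferentiable_heckeFun hN hk hf, isThetaAutomorphic_heckeFun hN hk hf,
    isBoundedAtImInfty_slashSq_heckeFun hf.2.2⟩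

/-- **`T(p²)` maps `S_{k/2}(N, χ)` to itself** (`k` odd, `4 ∣ N`, `p` prime).
[cite: Shimura1973HalfIntegral, Thm. 1.7] -/
theorem heckeFun_mem_cuspForms (hN : 4 ∣ N) (hk : Odd k) {f : ℍ → ℂ}
    (hf : f ∈ halfIntCuspForms k N χ) : heckeFun k χ p f ∈ halfIntCuspForms k N χ :=
  have hf' := halfIntCuspForms_le_halfIntModularForms k N χ hf
  ⟨mdifferentiable_heckeFun hN hk hf', isThetaAutomorphic_heckeFun hN hk hf',
    isZeroAtImInfty_slashSq_heckeFun hf.2.2⟩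

end HeckeG

/-- **Shimura 1973, Theorem 1.7** (the named fact `Shimura1973_heckeTSq_mem` of
`HalfIntegralWeightForms`, DISCHARGED): for `k` odd, `4 ∣ N`, `χ` modulo `N` and `p` prime, the
Hecke operator `T(p²)` — acting on `q`-expansions by `heckeTSq k χ p`,
`b(n) = a(p²n) + χ(p) ((-1)^λ n / p) p^{λ-1} a(n) + χ(p²) p^{k-2} a(n/p²)` — maps `M_{k/2}(N, χ)`
and `S_{k/2}(N, χ)` to themselves: for every `f` in the space, `g = T(p²) f` (`heckeFun k χ p f`,
the trace over `Γ₀(N) diag(1, p²) Γ₀(N)` built with Shimura's automorphy factor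
`j(γ, z) = θ(γz)/θ(z)`) lies in the space and has `qCoeffs g = heckeTSq k χ p (qCoeffs f)`.
Inputs proved in this file and its two predecessors: the transformation law of `θ` on `Γ₀(4)`
(`HalfIntegralWeightFormsThetaMultiplierProofs`), the sign of the quadratic Gauss sum
(`HalfIntegralWeightFormsGaussSumProofs`), the cocycle relation of `j`, the transversal
`{Tᵇ} ∪ {γ_s}` and its cofactors, the `q`-expansions of the three pieces, and the transport of
the cusp conditions along `z ↦ (Az + B)/D`. [cite: Shimura1973HalfIntegral, Thm. 1.7] -/
theorem Shimura1973_heckeTSq_mem_holds : Shimura1973_heckeTSq_mem := by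
  intro k N χ p hk hN hp
  haveI : Fact p.Prime := ⟨hp⟩
  exact ⟨fun f hf ↦ ⟨heckeFun k χ p f, heckeFun_mem hN hk hf, qCoeffs_heckeFun hN hk hf⟩,
    fun f hf ↦ ⟨heckeFun k χ p f, heckeFun_mem_cuspForms hN hk hf,
      qCoeffs_heckeFun hN hk (halfIntCuspForms_le_halfIntModularForms k N χ hf)⟩⟩

end Literature.NumberTheory.EllipticCurves.ModularForms
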